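import Literature.Computability.Cryptography.ChenQuantumLWEMeasurementThreshold

/-!
# Chen 2024 (withdrawn), Step 8 → Step 9: a READ-OUT BOUND for the Step-9 datum from the Step-8 register

REPRODUCTION / ANALYSIS OF A CLAIMED RESULT UNDER ADJUDICATION — header required by the tree's literature
rule.  Author: Yilei Chen.  Title: *Quantum Algorithms for Lattice Problems*.  Venue: IACR Cryptology ePrint
Archive, Paper 2024/555, version of 18 April 2024 (the main claim WITHDRAWN by the author, title-page note;
the bug is in Step 9, p. 37). [ChenQuantumLattice2024]  Printed page numbers.

HONEST FRAMING (bundle `papers/QuantumAdvantage/lwe-quantum-autopsy/`, Part 1, generation 10): the value of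
this file is a set of kernel-checked THEOREMS — a quantitative negative result about one step of a
withdrawn algorithm — NOT summit progress and no cryptanalytic claim in either direction (nothing here says
LWE is quantumly easy or hard; no algorithm is proposed, repaired or broken).

THE QUESTION.  Modules (O) `ChenQuantumLWEGeneralMeasurement`, (P) `ChenQuantumLWERobustMeasurement` and
(Q) `ChenQuantumLWEMeasurementThreshold` bound the reach of the INDISTINGUISHABILITY-CHAIN method: every
POVM on the Step-8 register that is (`ε`-almost) SURE on the class of instances consistent with the public
data gives an instance `S` and its companion `S′ = (b, v′ + 2D²p₁·b)` (same Step-8 output, different Step-9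
datum) the same outcome, whenever `4εQ² < 1`; and that conclusion provably FAILS at `ε₀ = 1/minFac(Q)²`
((Q), necessity).  They left open the DIRECT question ((Q), SCOPE (a)): can some general measurement of
`|φ7.d⟩` followed by classical post-processing OUTPUT the Step-9 datum `step9Needs = v′₀ mod D²P`
(`ChenQuantumLWESteps`) with constant confidence on every admissible instance?  This file answers NO, with
an explicit constant, for every POVM and every decoder, with no almost-sureness hypothesis at all.

WHAT IS DONE HERE.  Fix an admissible shape `S`, a tail coordinate `t₁+1` whose slope is unknown
(`U ∋ t₁+1`), ANY finite outcome type `κ`, ANY POVM `E` on the Step-8 register `ℂ[ℤ_M^{n+1}]` (module (O))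
and ANY decoder `dec : κ → ℤ_{D²P}`.
* **`Shape.step9Needs_readout_le`** (main theorem): some instance `(b₂, v₂)` of the class `InClass U` has
  success weight `Σ_{k : dec k = step9Needs} ⟨φ7.d|E_k|φ7.d⟩ ≤ (pairsCount(Q)/Q²)·⟨φ7.d|φ7.d⟩`, where
  `pairsCount(Q) = #{(η, β) ∈ ℤ_Q² : ηβ = 0}` (`= Σ_{k=1}^{Q} gcd(k, Q)`, Pillai's arithmetical function,
  [Bordelles2020ArithmeticTales, Exercise 76 p. 341] — the identification is not needed and not formalised):
  `pairsCount(Q) = 2Q − 1` for prime `Q` (`pairsCount_prime`), `≤ Q + (Q−1)·(Q/minFac Q)` in general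
  (`pairsCount_le`, Lagrange), hence `pairsCount(Q)/Q² < 2/3` for every odd `Q ≥ 3`
  (`three_mul_pairsCount_lt`, `Shape.pairsCount_div_sq_lt`).
* **`Shape.step9Needs_not_almostCertain_of_lt`**, **`Shape.step9Needs_not_almostCertain_third`**
  (`0 < n`, `E` valued in `ℤ_{D²P}` itself): for every `ε < 1 − pairsCount(Q)/Q²` — in particular for EVERY
  `ε ≤ 1/3` and every admissible shape — it is NOT the case that `step9Needs` is `ε`-almost certain
  (`POVM.AlmostCertain`, module (P)) on `|φ7.d⟩` of every admissible instance.  For this conclusion the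
  tolerance hypotheses `4εP² < 1` of (P)'s `Shape.step9Needs_not_almostSurely_measurable` and `4εQ² < 1` of
  (Q)'s `…_sharp` are thereby removed (those modules' ceiling theorems say more under their hypotheses —
  a same-outcome statement for all almost-sure POVMs — and are not superseded as such).

THE ARGUMENT (kernel-checked throughout).  Average over the `Q^{n+2}` instances
`(famB β, v′ + L·(x, ȳ))`, `L = 2D²p₁` (`M = L·Q`, `N = D²P = D²p₁·Q`): a dummy slope `2p₁β` is added at
coordinate `t₁+1`, `x ∈ ℤ_Q` shifts the head offset and `ȳ ∈ ℤ_Qⁿ` the tail offsets; every member is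
admissible and in the class (`inClass_fam`), all have the same norm `n₀ = (MD)^{n+1}·P·2ⁿ`
((P) `star_phi7d_dotProduct_phi7d_inst`), and the Step-9 datum of a member is `v′₀ + L·x (mod N)`,
INJECTIVE in `x` because `Q` is odd (`step9Needs_fam`, `label_inj`).
(1) FRAME.  `|φ7⟩` of a member expands over the frame vectors
`w_{η,m} = Σ_{i<P, k, y} amp7(i,k)·ψ_Q(m·i + ⟨η,y⟩)·|w(i,k,y)⟩` (`wv`; `w(i,k,y)` is the point of branch
`(i,k)` of the ZERO-SLOPE instance with tail offsets `y`, `wpt`, pairwise distinct by `wpt_inj`, so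
`⟨w_{η,m}|w_{η,m}⟩ = P·2ⁿ·Qⁿ`, `star_wv_dotProduct_wv`) with coefficients
`Q⁻ⁿ·ψ_Q(−⟨η,ȳ⟩ − 2p₁xσ_η − p₁x²)` at `m = −2(x + σ_η)`, `σ_η = Σ_t η_t·B_t` (`phi7_inst_expansion`): the
slopes enter `|φ7⟩` only through WHICH `y`-translate branch `i` lands in (`y_t ↦ y_t + i·B_t`), and the
finite Fourier transform in `y` turns that translation into the phase `ψ_Q(i·⟨η,B⟩)`.
(2) STEP 8 AS ONE MAP.  Step 8 (ii)–(v) is a linear map `T` on kets with `⟨Tf|Tg⟩ = (MD)^{n+1}·⟨f|g⟩`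
for kets supported on `D`-multiples off the head (`step8Map`, `phi7d_inst_eq_step8Map`, `step8Map_linComb`,
`dotProduct_step8Map`, from (O)'s `dotProduct_kick_kick` / `dotProduct_qft_qft`).
(3) SANDWICH (`sum_weight_fam_eq`; abstractly `sum_quadForm_fourier`).  For fixed `(β, x)` the sum over
`ȳ` of `⟨φ7.d|A|φ7.d⟩` is `Q⁻ⁿ·Σ_η ⟨T w_{η,m(η)}|A|T w_{η,m(η)}⟩`: the cross terms `η ≠ η′` vanish by
orthogonality of the characters `ȳ ↦ ψ_Q(−⟨η,ȳ⟩)` ((J) `sum_stdAddChar_linForm`), and the `x`-dependent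
unit phase drops out of each diagonal term (`POVM.weight_unimodular_mul`).
(4) COUNTING.  In block `η` the `Q` head offsets `x` with a common value of
`m = −2(x + σ₀(η) + η_{t₁}·β)` present the SAME vector `T w_{η,m}` but need `Q` DIFFERENT answers, so their
success weights sum to at most `⟨T w_{η,m}|T w_{η,m}⟩ = Qⁿ·n₀` (`POVM.sum_sum_filter_weight_re_le`); and
`β ↦ m` is `kerCount(η_{t₁})`-to-one, `kerCount(η) = #{β : ηβ = 0}` (`card_fibre_affine_le`,
`sum_comp_le_of_card_fibre_le`).  Summing over `η` (`card_mul_sum_apply_coord`,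
`pairsCount_eq_sum_kerCount`) the total success weight over the family is at most
`Qⁿ·pairsCount(Q)·n₀ = (pairsCount(Q)/Q²)·Q^{n+2}·n₀`, and pigeonhole gives the instance.

SCOPE (honest).  (a) TIGHTNESS is not formalised and not claimed: no measurement achieving
`pairsCount(Q)/Q²` (or any stated constant) on every instance is exhibited, so the optimal worst-case
probability of reading `step9Needs` off one copy of `|φ7.d⟩` is only bounded ABOVE here — by
`pairsCount(Q)/Q²`, which is `(2Q−1)/Q²` for prime `Q` and, for the square-free `Q = p₂⋯p_κ` of Chen's
Cond. C.3, equals `Π(2pᵢ−1)/Q²` by multiplicativity (not formalised; only `< 2/3` is used).  (b) The bound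
is on the AVERAGE over an explicit finite family inside the class, hence on the worst case; the family is a
proof device — no distribution on instances is part of the algorithm, and nothing is asserted about any
single named instance.  (c) As in (O)–(Q) the statements concern the Step-8 register state `|φ7.d⟩` of
eq. (35)/§3.5.8 as formalised in `ChenQuantumLWESteps` / `ChenQuantumLWEStepEight`, one run and one copy
of the state, and the class `Shape.InClass`; joint measurements on the states of several runs (Part 2's
tensor programme) and other algorithms for LWE are out of scope.  (d) Relation to Part 2 of the bundle:
`ChenQuantumLWEClassTwirl{,Sharp}` and `ChenQuantumLWEKickGuessCounting`
(`AdaptiveSafe.exists_guessSucc_le_inv_Q`) prove a `1/Q` bound of the same flavour (class average +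
character orthogonality) for guessing the Step-9 KICK by OFFSET-OBLIVIOUS processing of `|φ8.b⟩`; here the
register is Step 8's, the state itself varies with every unknown, the measurement and decoder are
unrestricted, and the price of the dummy slope is the factor `pairsCount(Q)/Q` instead of `1`.  (e) No
numerics enter any proof.

Everything is `sorry`-free over Mathlib and modules (A)–(Q) of the bundle (imported, nothing re-proved).
-/

namespace Literature.Computability.Cryptography.Chen2024

open scoped BigOperators ComplexOrder
open Matrix

/-! ### Counting: pairs with zero product in `ℤ_Q`, kernel sizes -/

/-- `kerCount Q η = #{β ∈ ℤ_Q : ηβ = 0}` — the size of the kernel of multiplication by `η`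
(`= gcd(η, Q)`). [folklore] -/
def kerCount (Q : ℕ) [NeZero Q] (η : ZMod Q) : ℕ :=
  (Finset.univ.filter fun β : ZMod Q => η * β = 0).card

/-- `pairsCount Q = #{(η, β) ∈ ℤ_Q × ℤ_Q : ηβ = 0}` (`= Σ_{k=1}^{Q} gcd(k, Q)`, Pillai's arithmetical
function; `2Q − 1` for a prime `Q`). [folklore] -/
def pairsCount (Q : ℕ) [NeZero Q] : ℕ :=
  (Finset.univ.filter fun p : ZMod Q × ZMod Q => p.1 * p.2 = 0).card

/-- `pairsCount Q = Σ_η kerCount Q η`. [folklore] -/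
theorem pairsCount_eq_sum_kerCount (Q : ℕ) [NeZero Q] :
    pairsCount Q = ∑ η : ZMod Q, kerCount Q η := by
  unfold pairsCount kerCount
  rw [Finset.card_filter, Fintype.sum_prod_type]
  refine Finset.sum_congr rfl fun η _ => ?_
  rw [Finset.card_filter]

/-- `kerCount Q 0 = Q`. [folklore] -/
theorem kerCount_zero (Q : ℕ) [NeZero Q] : kerCount Q 0 = Q := by
  unfold kerCount
  rw [Finset.filter_true_of_mem fun β _ => zero_mul β, Finset.card_univ, ZMod.card]

/-- For a unit `η`, `kerCount Q η = 1`. [folklore] -/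
theorem kerCount_of_isUnit (Q : ℕ) [NeZero Q] {η : ZMod Q} (hη : IsUnit η) : kerCount Q η = 1 := by
  unfold kerCount
  rw [Finset.card_eq_one]
  refine ⟨0, Finset.eq_singleton_iff_unique_mem.2 ⟨by simp, fun β hβ => ?_⟩⟩
  exact (hη.mul_right_eq_zero).1 (Finset.mem_filter.1 hβ).2

/-- `1 ≤ kerCount Q η` (`β = 0` is always in the kernel). [folklore] -/
theorem one_le_kerCount (Q : ℕ) [NeZero Q] (η : ZMod Q) : 1 ≤ kerCount Q η := by
  unfold kerCount
  exact Finset.card_pos.2 ⟨0, Finset.mem_filter.2 ⟨Finset.mem_univ _, mul_zero η⟩⟩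

/-- The kernel of multiplication by `η ≠ 0` is a proper subgroup of `ℤ_Q`, so by Lagrange its size is at
most `Q / minFac Q`. [folklore] -/
theorem kerCount_le_div_minFac (Q : ℕ) [NeZero Q] {η : ZMod Q} (hη : η ≠ 0) :
    kerCount Q η ≤ Q / Nat.minFac Q := by
  classical
  -- the kernel as an additive subgroup
  set K : AddSubgroup (ZMod Q) := (AddMonoidHom.mulLeft η).ker with hK
  have hmem : ∀ β : ZMod Q, β ∈ K ↔ η * β = 0 := fun β => by
    rw [hK, AddMonoidHom.mem_ker]
    exact Iff.rfl
  have hcardK : Nat.card K = kerCount Q η := by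
    rw [Nat.card_eq_fintype_card, kerCount, Fintype.card_subtype]
    congr 1
    exact Finset.filter_congr fun β _ => hmem β
  have hdvd : kerCount Q η ∣ Q := by
    have h := AddSubgroup.card_addSubgroup_dvd_card K
    rwa [hcardK, Nat.card_zmod] at h
  have hne : kerCount Q η ≠ Q := by
    intro hQ
    have huniv : (Finset.univ.filter fun β : ZMod Q => η * β = 0) = Finset.univ :=
      Finset.eq_univ_of_card _ (by rw [← kerCount, hQ, ZMod.card])
    have h1 : (1 : ZMod Q) ∈ Finset.univ.filter fun β : ZMod Q => η * β = 0 := by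
      rw [huniv]; exact Finset.mem_univ _
    exact hη (by simpa using (Finset.mem_filter.1 h1).2)
  obtain ⟨d, hd⟩ := hdvd
  have hQ0 : Q ≠ 0 := NeZero.ne Q
  have hk0 : kerCount Q η ≠ 0 := Nat.one_le_iff_ne_zero.1 (one_le_kerCount Q η)
  have hd2 : 2 ≤ d := by
    rcases Nat.lt_or_ge d 2 with hlt | hge
    · interval_cases d
      · exact absurd (hd.trans (mul_zero _)) hQ0
      · exact absurd ((mul_one _).symm.trans hd.symm) hne
    · exact hge
  have hmin : Nat.minFac Q ≤ d := Nat.minFac_le_of_dvd hd2 ⟨kerCount Q η, hd.trans (mul_comm _ _)⟩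
  have hpos : 0 < Nat.minFac Q := Nat.minFac_pos Q
  rw [Nat.le_div_iff_mul_le hpos]
  calc kerCount Q η * Nat.minFac Q ≤ kerCount Q η * d := Nat.mul_le_mul_left _ hmin
    _ = Q := hd.symm

/-- For a prime `Q`: `pairsCount Q = 2Q − 1`. [folklore] -/
theorem pairsCount_prime {Q : ℕ} [NeZero Q] (hQ : Q.Prime) : pairsCount Q = 2 * Q - 1 := by
  classical
  haveI : Fact Q.Prime := ⟨hQ⟩
  rw [pairsCount_eq_sum_kerCount, ← Finset.add_sum_erase _ _ (Finset.mem_univ (0 : ZMod Q)),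
    kerCount_zero]
  have h1 : ∀ η ∈ Finset.univ.erase (0 : ZMod Q), kerCount Q η = 1 := fun η hη =>
    kerCount_of_isUnit Q (Ne.isUnit (Finset.mem_erase.1 hη).1)
  rw [Finset.sum_congr rfl h1, Finset.sum_const, smul_eq_mul, mul_one, Finset.card_erase_of_mem
    (Finset.mem_univ _), Finset.card_univ, ZMod.card]
  have := hQ.one_lt
  omega

/-- In general: `pairsCount Q ≤ Q + (Q − 1)·(Q / minFac Q)`. [folklore] -/
theorem pairsCount_le (Q : ℕ) [NeZero Q] : pairsCount Q ≤ Q + (Q - 1) * (Q / Nat.minFac Q) := by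
  classical
  rw [pairsCount_eq_sum_kerCount, ← Finset.add_sum_erase _ _ (Finset.mem_univ (0 : ZMod Q)),
    kerCount_zero]
  refine Nat.add_le_add_left ?_ Q
  calc ∑ η ∈ Finset.univ.erase (0 : ZMod Q), kerCount Q η
      ≤ ∑ η ∈ Finset.univ.erase (0 : ZMod Q), Q / Nat.minFac Q :=
        Finset.sum_le_sum fun η hη => kerCount_le_div_minFac Q (Finset.mem_erase.1 hη).1
    _ = (Q - 1) * (Q / Nat.minFac Q) := by
        rw [Finset.sum_const, smul_eq_mul, Finset.card_erase_of_mem (Finset.mem_univ _),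
          Finset.card_univ, ZMod.card]

/-- For odd `Q ≥ 3`: `3·pairsCount Q < 2Q²` (so `pairsCount Q / Q² < 2/3`). [folklore] -/
theorem three_mul_pairsCount_lt {Q : ℕ} [NeZero Q] (hQ : Odd Q) (h3 : 3 ≤ Q) :
    3 * pairsCount Q < 2 * Q ^ 2 := by
  have hmin3 : 3 ≤ Nat.minFac Q := by
    have h2 : 2 ≤ Nat.minFac Q := (Nat.minFac_prime (by omega)).two_le
    rcases h2.eq_or_lt with h | h
    · exfalso
      have hdvd : 2 ∣ Q := by rw [h]; exact Nat.minFac_dvd Q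
      exact (Nat.not_even_iff_odd.2 hQ) (even_iff_two_dvd.2 hdvd)
    · omega
  have hdiv : 3 * (Q / Nat.minFac Q) ≤ Q :=
    calc 3 * (Q / Nat.minFac Q) ≤ Nat.minFac Q * (Q / Nat.minFac Q) := Nat.mul_le_mul_right _ hmin3
      _ ≤ Q := Nat.mul_div_le Q _
  have h1 := pairsCount_le Q
  have h2 : 3 * pairsCount Q ≤ 3 * Q + (Q - 1) * Q := by
    calc 3 * pairsCount Q ≤ 3 * (Q + (Q - 1) * (Q / Nat.minFac Q)) := Nat.mul_le_mul_left 3 h1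
      _ = 3 * Q + (Q - 1) * (3 * (Q / Nat.minFac Q)) := by ring
      _ ≤ 3 * Q + (Q - 1) * Q := by
          exact Nat.add_le_add_left (Nat.mul_le_mul_left _ hdiv) _
  have h4 : 3 * Q + (Q - 1) * Q < 2 * Q ^ 2 := by
    obtain ⟨q, rfl⟩ : ∃ q, Q = q + 3 := ⟨Q - 3, by omega⟩
    rw [show q + 3 - 1 = q + 2 by omega]
    nlinarith
  omega

/-- In `ℤ_Q` with `Q` odd, `2a = 0 ⇒ a = 0`. [folklore] -/
theorem eq_zero_of_two_mul_eq_zero {Q : ℕ} (hQ : Odd Q) {a : ZMod Q} (h : 2 * a = 0) : a = 0 := by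
  obtain ⟨r, hr⟩ := hQ
  have hQz : ((2 * r + 1 : ℕ) : ZMod Q) = 0 := by
    rw [← hr]
    exact ZMod.natCast_self _
  push_cast at hQz
  have h2 : (2 : ZMod Q) * ((r : ℕ) + 1) = 1 := by linear_combination hQz
  calc a = (2 * ((r : ℕ) + 1 : ZMod Q)) * a := by rw [h2, one_mul]
    _ = (((r : ℕ) : ZMod Q) + 1) * (2 * a) := by ring
    _ = 0 := by rw [h, mul_zero]

/-- Fibres of `β ↦ −2(x + (σ₀ + η₁β))` have at most `kerCount Q η₁` elements (`Q` odd). [folklore] -/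
theorem card_fibre_affine_le {Q : ℕ} [NeZero Q] (hQ : Odd Q) (x σ₀ η₁ m : ZMod Q) :
    (Finset.univ.filter fun β : ZMod Q => -2 * (x + (σ₀ + η₁ * β)) = m).card ≤ kerCount Q η₁ := by
  classical
  by_cases hne : (Finset.univ.filter fun β : ZMod Q => -2 * (x + (σ₀ + η₁ * β)) = m).Nonempty
  · obtain ⟨β₀, hβ₀⟩ := hne
    have h₀ := (Finset.mem_filter.1 hβ₀).2
    unfold kerCount
    refine Finset.card_le_card_of_injOn (fun β => β - β₀) (fun β hβ => ?_) ?_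
    · have hβ' := (Finset.mem_filter.1 (Finset.mem_coe.1 hβ)).2
      refine Finset.mem_coe.2 (Finset.mem_filter.2 ⟨Finset.mem_univ _, ?_⟩)
      apply eq_zero_of_two_mul_eq_zero hQ
      linear_combination h₀ - hβ'
    · intro β _ β' _ hββ'
      simpa using hββ'
  · rw [Finset.not_nonempty_iff_eq_empty.1 hne, Finset.card_empty]
    exact Nat.zero_le _

/-- **Fibre-count bound for a sum along a map.** If every fibre of `g` has at most `K` elements and
`f ≥ 0` then `Σ_a f(g a) ≤ K · Σ_c f c`. [folklore] -/
theorem sum_comp_le_of_card_fibre_le {ι κ : Type*} [Fintype ι] [Fintype κ] [DecidableEq κ]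
    (g : ι → κ) (f : κ → ℝ) (hf : ∀ c, 0 ≤ f c) (K : ℕ)
    (hK : ∀ c, (Finset.univ.filter fun a => g a = c).card ≤ K) :
    ∑ a, f (g a) ≤ (K : ℝ) * ∑ c, f c := by
  classical
  rw [Finset.sum_comp]
  calc ∑ b ∈ Finset.univ.image g, (Finset.univ.filter fun a => g a = b).card • f b
      ≤ ∑ b ∈ Finset.univ.image g, (K : ℝ) * f b := by
        refine Finset.sum_le_sum fun b _ => ?_
        rw [nsmul_eq_mul]
        exact mul_le_mul_of_nonneg_right (by exact_mod_cast hK b) (hf b)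
    _ ≤ ∑ b, (K : ℝ) * f b :=
        Finset.sum_le_sum_of_subset_of_nonneg (Finset.subset_univ _)
          fun b _ _ => mul_nonneg (Nat.cast_nonneg K) (hf b)
    _ = (K : ℝ) * ∑ c, f c := by rw [Finset.mul_sum]

/-- **Summing a function of one coordinate.** `#α · Σ_{η ∈ α^m} f(η t) = #α^m · Σ_a f a`. [folklore] -/
theorem card_mul_sum_apply_coord {α R : Type*} [Fintype α] [CommSemiring R] {m : ℕ} (t : Fin m)
    (f : α → R) :
    (Fintype.card α : R) * ∑ η : Fin m → α, f (η t) = (Fintype.card α : R) ^ m * ∑ a, f a := by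
  classical
  cases m with
  | zero => exact t.elim0
  | succ m =>
    rw [← Fintype.sum_equiv (Fin.insertNthEquiv (fun _ => α) t) (fun p => f p.1) (fun η => f (η t))
      (fun p => by simp [Fin.insertNthEquiv, Fin.insertNth_apply_same])]
    rw [Fintype.sum_prod_type]
    simp only [Finset.sum_const, Finset.card_univ, Fintype.card_pi, Finset.prod_const,
      Fintype.card_fin, nsmul_eq_mul, Nat.cast_pow]
    rw [← Finset.mul_sum]
    ring

/-! ### POVM bookkeeping -/

namespace POVM

variable {X κ : Type*} [Fintype X] [DecidableEq X] [Fintype κ] (E : POVM X κ)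

/-- **Disjoint read-outs share the total weight.** For a decoder `dec : κ → α` and pairwise distinct
target labels `ℓ x` (`x ∈ T`), on ONE state `w` the success weights add up to at most `⟨w|w⟩`:
`Σ_{x ∈ T} Σ_{k : dec k = ℓ x} ⟨w|E_k|w⟩ ≤ ⟨w|w⟩`. [cite: NielsenChuang2010, §2.2.6 p. 90] -/
theorem sum_sum_filter_weight_re_le {α ι : Type*} [DecidableEq α] (dec : κ → α) (T : Finset ι)
    (ℓ : ι → α) (hℓ : Set.InjOn ℓ T) (w : X → ℂ) :
    ∑ x ∈ T, ∑ k ∈ Finset.univ.filter (fun k => dec k = ℓ x), (E.weight w k).re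
      ≤ (star w ⬝ᵥ w).re := by
  classical
  have hk : ∀ k : κ, (∑ x ∈ T, if dec k = ℓ x then (E.weight w k).re else 0) ≤ (E.weight w k).re := by
    intro k
    rw [Finset.sum_ite, Finset.sum_const_zero, add_zero, Finset.sum_const, nsmul_eq_mul]
    have hc : ((T.filter fun x => dec k = ℓ x).card : ℝ) ≤ 1 := by
      have : (T.filter fun x => dec k = ℓ x).card ≤ 1 :=
        Finset.card_le_one_iff.2 fun {a b} ha hb =>
          hℓ (Finset.mem_filter.1 ha).1 (Finset.mem_filter.1 hb).1
            ((Finset.mem_filter.1 ha).2.symm.trans (Finset.mem_filter.1 hb).2)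
      exact_mod_cast this
    have h0 := E.weight_re_nonneg w k
    nlinarith
  calc ∑ x ∈ T, ∑ k ∈ Finset.univ.filter (fun k => dec k = ℓ x), (E.weight w k).re
      = ∑ x ∈ T, ∑ k, if dec k = ℓ x then (E.weight w k).re else 0 := by
        refine Finset.sum_congr rfl fun x _ => ?_
        rw [Finset.sum_filter]
    _ = ∑ k, ∑ x ∈ T, if dec k = ℓ x then (E.weight w k).re else 0 := Finset.sum_comm
    _ ≤ ∑ k, (E.weight w k).re := Finset.sum_le_sum fun k _ => hk k
    _ = (star w ⬝ᵥ w).re := E.sum_weight_re w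

/-- The weight of a set `F` of outcomes is the expectation of the effect `Σ_{k ∈ F} E_k`.
[cite: NielsenChuang2010, §2.2.6 p. 90] -/
theorem sum_weight_eq_dotProduct (F : Finset κ) (w : X → ℂ) :
    ∑ k ∈ F, E.weight w k = star w ⬝ᵥ ((∑ k ∈ F, E.effect k) *ᵥ w) := by
  unfold weight
  rw [Matrix.sum_mulVec, dotProduct_sum]

/-- A unimodular scalar does not change weights. [cite: NielsenChuang2010, §2.2.6 p. 90] -/
theorem weight_unimodular_mul {a : ℂ} (ha : (starRingEnd ℂ) a * a = 1) (w : X → ℂ) (k : κ) :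
    E.weight (fun p => a * w p) k = E.weight w k := by
  unfold weight
  have h1 : (fun p => a * w p) = a • w := by
    funext p
    simp [Pi.smul_apply, smul_eq_mul]
  rw [h1, star_smul, Matrix.mulVec_smul, smul_dotProduct, dotProduct_smul, Complex.star_def, smul_smul,
    ha, one_smul]

end POVM

/-! ### A sesquilinear form on a character combination, summed over the dual variable -/

/-- Expanding a quadratic form on a finite linear combination. [folklore] -/
theorem quadForm_linComb {X ι : Type*} [Fintype X] [Fintype ι] (A : Matrix X X ℂ) (a : ι → ℂ)
    (u : ι → X → ℂ) (f : X → ℂ) (hf : ∀ p, f p = ∑ i, a i * u i p) :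
    star f ⬝ᵥ (A *ᵥ f) = ∑ i, ∑ j, (starRingEnd ℂ) (a i) * a j * (star (u i) ⬝ᵥ (A *ᵥ u j)) := by
  have hf' : f = ∑ i, a i • u i := by
    funext p
    rw [hf p, Finset.sum_apply]
    simp [Pi.smul_apply, smul_eq_mul]
  rw [hf', star_sum, Matrix.mulVec_sum, sum_dotProduct]
  refine Finset.sum_congr rfl fun i _ => ?_
  rw [dotProduct_sum]
  refine Finset.sum_congr rfl fun j _ => ?_
  rw [star_smul, Matrix.mulVec_smul, smul_dotProduct, dotProduct_smul, Complex.star_def, smul_smul,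
    smul_eq_mul]

/-- **Fourier sandwich.** If `φ_y = c·Σ_η ψ_Q(−⟨η,y⟩)·u_η` (`y ∈ ℤ_Qⁿ`) then for every matrix `A`,
`Σ_y ⟨φ_y|A|φ_y⟩ = |c|²·Qⁿ·Σ_η ⟨u_η|A|u_η⟩` — the cross terms die under `Σ_y` by orthogonality of
characters; no orthogonality of the `u_η` is needed. [folklore] -/
theorem sum_quadForm_fourier {X : Type*} [Fintype X] {n Q : ℕ} [NeZero Q] (A : Matrix X X ℂ)
    (u : (Fin n → ZMod Q) → X → ℂ) (c : ℂ) (φ : (Fin n → ZMod Q) → X → ℂ)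
    (hφ : ∀ y p, φ y p = c * ∑ η : Fin n → ZMod Q, ZMod.stdAddChar (-(∑ t, η t * y t)) * u η p) :
    ∑ y, star (φ y) ⬝ᵥ (A *ᵥ φ y)
      = (starRingEnd ℂ) c * c * ((Q : ℂ)) ^ n * ∑ η, star (u η) ⬝ᵥ (A *ᵥ u η) := by
  classical
  set ψ := ZMod.stdAddChar (N := Q) with hψ
  -- expand each quadratic form
  have hexp : ∀ y : Fin n → ZMod Q, star (φ y) ⬝ᵥ (A *ᵥ φ y)
      = ∑ η, ∑ η', (starRingEnd ℂ) c * c * (ψ (∑ t, (η t - η' t) * y t)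
          * (star (u η) ⬝ᵥ (A *ᵥ u η'))) := by
    intro y
    rw [quadForm_linComb A (fun η => c * ψ (-(∑ t, η t * y t))) u (φ y)
      (fun p => by rw [hφ y p, Finset.mul_sum]; exact Finset.sum_congr rfl fun η _ => by ring)]
    refine Finset.sum_congr rfl fun η _ => Finset.sum_congr rfl fun η' _ => ?_
    rw [map_mul, ← AddChar.map_neg_eq_conj, neg_neg]
    have hadd : ψ (∑ t, η t * y t) * ψ (-(∑ t, η' t * y t)) = ψ (∑ t, (η t - η' t) * y t) := by
      rw [← AddChar.map_add_eq_mul]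
      congr 1
      rw [← sub_eq_add_neg, ← Finset.sum_sub_distrib]
      exact Finset.sum_congr rfl fun t _ => by ring
    calc (starRingEnd ℂ) c * ψ (∑ t, η t * y t) * (c * ψ (-(∑ t, η' t * y t)))
          * (star (u η) ⬝ᵥ (A *ᵥ u η'))
        = (starRingEnd ℂ) c * c * ((ψ (∑ t, η t * y t) * ψ (-(∑ t, η' t * y t)))
            * (star (u η) ⬝ᵥ (A *ᵥ u η'))) := by ring
      _ = _ := by rw [hadd]
  simp_rw [hexp]
  -- move the sum over `y` inside
  rw [Finset.sum_comm]
  simp_rw [Finset.sum_comm (s := (Finset.univ : Finset (Fin n → ZMod Q)))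
    (t := (Finset.univ : Finset (Fin n → ZMod Q))) (f := fun y η' => (starRingEnd ℂ) c * c
      * (ψ (∑ t, (_ - η' t) * y t) * (star (u _) ⬝ᵥ (A *ᵥ u η'))))]
  rw [Finset.mul_sum]
  refine Finset.sum_congr rfl fun η _ => ?_
  have hinner : ∀ η' : Fin n → ZMod Q,
      ∑ y : Fin n → ZMod Q, (starRingEnd ℂ) c * c * (ψ (∑ t, (η t - η' t) * y t)
        * (star (u η) ⬝ᵥ (A *ᵥ u η')))
        = (starRingEnd ℂ) c * c * ((if η - η' = 0 then ((Q : ℂ)) ^ n else 0)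
            * (star (u η) ⬝ᵥ (A *ᵥ u η'))) := by
    intro η'
    rw [← Finset.mul_sum, ← Finset.sum_mul]
    congr 2
    have h := sum_stdAddChar_linForm (η - η')
    simp only [Pi.sub_apply] at h
    rw [← h]
  rw [Finset.sum_congr rfl fun η' _ => hinner η']
  simp_rw [sub_eq_zero, ite_mul, zero_mul, mul_ite, mul_zero]
  rw [Finset.sum_ite_eq Finset.univ η, if_pos (Finset.mem_univ _)]
  ring

/-- **`⟨w|w⟩ = #points`** for a sum of unimodular amplitudes on distinct basis points. [folklore] -/
theorem star_dotProduct_self_pointSum {X ι : Type*} [Fintype X] [DecidableEq X] [DecidableEq ι]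
    (s : Finset ι) (pt : ι → X) (c : ι → ℂ) (hinj : Set.InjOn pt s)
    (hc : ∀ a ∈ s, (starRingEnd ℂ) (c a) * c a = 1) (w : X → ℂ)
    (hw : ∀ z, w z = ∑ a ∈ s, if z = pt a then c a else 0) :
    star w ⬝ᵥ w = (s.card : ℂ) := by
  have hpt : ∀ a ∈ s, w (pt a) = c a := by
    intro a ha
    rw [hw, Finset.sum_eq_single_of_mem a ha]
    · rw [if_pos rfl]
    · intro b hb hba
      rw [if_neg]
      intro hab
      exact hba (hinj hb ha hab.symm)
  have hzero : ∀ z, z ∉ s.image pt → w z = 0 := by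
    intro z hz
    rw [hw]
    refine Finset.sum_eq_zero fun a ha => ?_
    rw [if_neg]
    rintro rfl
    exact hz (Finset.mem_image_of_mem pt ha)
  simp only [dotProduct, Pi.star_apply, Complex.star_def]
  rw [← Finset.sum_subset (Finset.subset_univ (s.image pt))
    (fun z _ hz => by rw [hzero z hz, mul_zero]), Finset.sum_image hinj]
  rw [Finset.sum_congr rfl fun a ha => by rw [hpt a ha, hc a ha], Finset.sum_const, nsmul_eq_mul, mul_one]


namespace Shape

variable (S : Shape)

/-! ### The instance class in coordinates: `v′ + L·c`, the frame points and frame vectors -/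

/-- `L := 2D²p₁ = M/Q`. Offsets `v′ + L·c` (`c ∈ ℤⁿ⁺¹`) stay in `Dℤ` (admissible) and are invisible
modulo `D²p₁`, but `v′₀ + L·x` runs through `Q` distinct residues modulo `N = D²P` — the datum Step 9
needs. [cite: ChenQuantumLattice2024, Cond. C.3 p. 18, §3.5.8 p. 34] -/
def L : ℤ := 2 * (S.D : ℤ) * S.D * S.p₁

/-- `M = L·Q`. [cite: ChenQuantumLattice2024, Cond. C.3 p. 18] -/
theorem M_eq_L_mul_Q : ((S.M : ℕ) : ℤ) = S.L * S.Q := by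
  rw [S.M_coe, S.P_coe, L]; ring

/-- `N = D²p₁Q`. [cite: ChenQuantumLattice2024, Cond. C.3 p. 18] -/
theorem N_eq_DDpQ : ((S.N : ℕ) : ℤ) = (S.D : ℤ) * S.D * S.p₁ * S.Q := by
  rw [S.N_coe, S.P_coe]; ring

/-- `D ∣ L`. [cite: ChenQuantumLattice2024, Cond. C.3 p. 18] -/
theorem D_dvd_L : (S.D : ℤ) ∣ S.L := ⟨2 * (S.D : ℤ) * S.p₁, by rw [L]; ring⟩

/-- The all-zero tail slope vector `b⁰ = (−1, 0, …, 0)` (an admissible `b`: `2p₁ ∣ 0`).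
[cite: ChenQuantumLattice2024, §3.1 p. 22] -/
def b0 : Fin (S.n + 1) → ℤ := Fin.cons (-1) fun _ => 0

/-- The offset `v′ + L·c`. [cite: ChenQuantumLattice2024, §3.5.8 p. 34] -/
def vOf (c : Fin (S.n + 1) → ℤ) : Fin (S.n + 1) → ℤ := fun i => S.v' i + S.L * c i

/-- The coefficient vector `(0, y)` of a tail residue vector `y ∈ ℤ_Qⁿ`. [folklore] -/
def yv (y : Fin S.n → ZMod S.Q) : Fin (S.n + 1) → ℤ := Fin.cons 0 fun t => ((y t).val : ℤ)

/-- The coefficient vector `(x, yb)` of residues `x ∈ ℤ_Q`, `yb ∈ ℤ_Qⁿ`. [folklore] -/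
def xyv (x : ZMod S.Q) (yb : Fin S.n → ZMod S.Q) : Fin (S.n + 1) → ℤ :=
  Fin.cons (x.val : ℤ) fun t => ((yb t).val : ℤ)

/-- `b⁰₀ = −1`. [folklore] -/
@[simp] theorem b0_zero : S.b0 0 = -1 := by simp [b0]
/-- `b⁰_{t+1} = 0`. [folklore] -/
@[simp] theorem b0_succ (t : Fin S.n) : S.b0 t.succ = 0 := by simp [b0]
/-- `(0, y)₀ = 0`. [folklore] -/
@[simp] theorem yv_zero (y : Fin S.n → ZMod S.Q) : S.yv y 0 = 0 := by simp [yv]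
/-- `(0, y)_{t+1} = y_t`. [folklore] -/
@[simp] theorem yv_succ (y : Fin S.n → ZMod S.Q) (t : Fin S.n) : S.yv y t.succ = ((y t).val : ℤ) := by
  simp [yv]
/-- `(x, ȳ)₀ = x`. [folklore] -/
@[simp] theorem xyv_zero (x : ZMod S.Q) (yb : Fin S.n → ZMod S.Q) : S.xyv x yb 0 = (x.val : ℤ) := by
  simp [xyv]
/-- `(x, ȳ)_{t+1} = ȳ_t`. [folklore] -/
@[simp] theorem xyv_succ (x : ZMod S.Q) (yb : Fin S.n → ZMod S.Q) (t : Fin S.n) :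
    S.xyv x yb t.succ = ((yb t).val : ℤ) := by
  simp [xyv]
/-- `(v′ + L·c)_i = v′_i + L·c_i`. [folklore] -/
theorem vOf_apply (c : Fin (S.n + 1) → ℤ) (i : Fin (S.n + 1)) : S.vOf c i = S.v' i + S.L * c i := rfl

/-- `(b′, v′ + L·c)` is admissible whenever `b′` is (`D ∣ L`). [cite: ChenQuantumLattice2024, Cond. C.3 p. 18] -/
theorem inst_vOf_admissible (h : S.Admissible) {b' : Fin (S.n + 1) → ℤ} (hb0 : b' 0 = -1)
    (hbt : ∀ i, i ≠ 0 → (2 * (S.p₁ : ℤ)) ∣ b' i) (c : Fin (S.n + 1) → ℤ) :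
    (S.inst b' (S.vOf c)).Admissible :=
  S.inst_admissible h hb0 hbt fun i => dvd_add (h.v'_in_DZ i) (dvd_mul_of_dvd_left S.D_dvd_L _)

/-- `(b⁰, v′ + L·c)` is admissible. [cite: ChenQuantumLattice2024, Cond. C.3 p. 18] -/
theorem inst_b0_admissible (h : S.Admissible) (c : Fin (S.n + 1) → ℤ) :
    (S.inst S.b0 (S.vOf c)).Admissible :=
  S.inst_vOf_admissible h S.b0_zero (fun i hi => by
    obtain ⟨t, rfl⟩ := Fin.exists_succ_eq.2 hi
    rw [b0_succ]; exact dvd_zero _) c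

/-- The FRAME POINT `w(i,k,y) := (v′₀ − 2D²i, (v′_{t+1} + L·y_t + N·k_t)_t) ∈ ℤ_Mⁿ⁺¹` — the point of branch
`(i,k)` of `|φ7⟩` of the zero-slope instance `(b⁰, v′ + L·(0,y))`. [cite: ChenQuantumLattice2024, eq. (35) p. 31] -/
def wpt (i : ℕ) (k : Fin S.n → Fin 2) (y : Fin S.n → ZMod S.Q) : Fin (S.n + 1) → ZMod S.M :=
  (S.inst S.b0 (S.vOf (S.yv y))).pt7 i k

/-- Head coordinate of a frame point: `v′₀ − 2D²i`. [cite: ChenQuantumLattice2024, eq. (35) p. 31] -/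
theorem wpt_zero (i : ℕ) (k : Fin S.n → Fin 2) (y : Fin S.n → ZMod S.Q) :
    S.wpt i k y 0 = ((S.v' 0 - 2 * (S.D : ℤ) * S.D * i : ℤ) : ZMod S.M) := by
  rw [wpt, pt7_inst_apply, kLift_zero, b0_zero, vOf_apply, yv_zero]
  congr 1; ring

/-- Tail coordinate `t+1` of a frame point: `v′_{t+1} + L·y_t + N·k_t`. [cite: ChenQuantumLattice2024, eq. (35) p. 31] -/
theorem wpt_succ (i : ℕ) (k : Fin S.n → Fin 2) (y : Fin S.n → ZMod S.Q) (t : Fin S.n) :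
    S.wpt i k y t.succ = ((S.v' t.succ + S.L * (y t).val + (S.N : ℤ) * (k t : ℕ) : ℤ) : ZMod S.M) := by
  rw [wpt, pt7_inst_apply, kLift_succ, b0_succ, vOf_apply, yv_succ]
  congr 1; ring

/-- **The frame points are pairwise distinct** (`i < P`): coordinate `0` determines `i` (`2D²(i′−i) ≡ 0
mod M ⇒ P ∣ i′−i`), the tail determines `k` (parity modulo `2D²`) and `y` (`L(y−y′) ≡ 0 mod M ⇒ Q ∣ y−y′`).
[cite: ChenQuantumLattice2024, §3.5.6 p. 31 ("one can always guess x₁ correctly")] -/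
theorem wpt_inj (h : S.Admissible) {i i' : ℕ} (hi : i < (S.P : ℕ)) (hi' : i' < (S.P : ℕ))
    {k k' : Fin S.n → Fin 2} {y y' : Fin S.n → ZMod S.Q} (heq : S.wpt i k y = S.wpt i' k' y') :
    i = i' ∧ k = k' ∧ y = y' := by
  have heq' : (S.inst S.b0 (S.vOf (S.yv y))).pt7 i k = (S.inst S.b0 (S.vOf (S.yv y'))).pt7 i' k' := heq
  have htail : ∀ t : Fin S.n, S.vOf (S.yv y') t.succ - S.vOf (S.yv y) t.succ
      = 2 * (S.D : ℤ) * S.D * ((S.p₁ : ℤ) * (((y' t).val : ℤ) - (y t).val)) := fun t => by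
    rw [vOf_apply, vOf_apply, yv_succ, yv_succ, L]; ring
  have hk : k = k' := coincidence_k (S.odd_P h) heq' fun t => ⟨_, htail t⟩
  have hii : i = i' := by
    have hd := coincidence_head heq' S.b0_zero S.b0_zero 0
      (by rw [vOf_apply, vOf_apply, yv_zero, yv_zero]; ring)
    rw [sub_zero] at hd
    exact nat_eq_of_dvd_sub_of_lt hi hi' hd
  refine ⟨hii, hk, funext fun t => ?_⟩
  have ht := coincidence_tail heq' t (congr_fun hk t) _ (htail t)
  rw [b0_succ, mul_zero, mul_zero, sub_zero, zero_sub, S.P_coe, dvd_neg] at ht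
  have hp : (S.p₁ : ℤ) ≠ 0 := by exact_mod_cast S.p₁.ne_zero
  have hQ : ((S.Q : ℕ) : ℤ) ∣ ((y' t).val : ℤ) - (y t).val := (mul_dvd_mul_iff_left hp).1 ht
  exact ZMod.val_injective _ (nat_eq_of_dvd_sub_of_lt (ZMod.val_lt (y t)) (ZMod.val_lt (y' t)) hQ)

/-- The FRAME VECTOR `w_{η,m} := Σ_{i<P, k, y} amp7(i,k)·ψ_Q(m·i + ⟨η,y⟩)·|w(i,k,y)⟩` (`η ∈ ℤ_Qⁿ`, `m ∈ ℤ_Q`):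
the partial Fourier transform, in the unknown tail offsets, of the `|φ7⟩`'s of the class. [folklore] -/
noncomputable def wv (η : Fin S.n → ZMod S.Q) (m : ZMod S.Q) : Ket (S.n + 1) S.M :=
  fun z => ∑ i ∈ Finset.range S.P, ∑ k : Fin S.n → Fin 2, ∑ y : Fin S.n → ZMod S.Q,
    if z = S.wpt i k y then S.amp7 i k * ZMod.stdAddChar (m * (i : ZMod S.Q) + ∑ t, η t * y t) else 0

/-- The frame vector as ONE point sum over the index set `[0,P) × {0,1}ⁿ × ℤ_Qⁿ`. [folklore] -/
theorem wv_eq_pointSum (η : Fin S.n → ZMod S.Q) (m : ZMod S.Q) (z : Fin (S.n + 1) → ZMod S.M) :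
    S.wv η m z = ∑ a ∈ (Finset.range (S.P : ℕ)) ×ˢ ((Finset.univ : Finset (Fin S.n → Fin 2)) ×ˢ
        (Finset.univ : Finset (Fin S.n → ZMod S.Q))),
      if z = S.wpt a.1 a.2.1 a.2.2 then
        S.amp7 a.1 a.2.1 * ZMod.stdAddChar (m * (a.1 : ZMod S.Q) + ∑ t, η t * a.2.2 t) else 0 := by
  rw [wv, Finset.sum_product]
  refine Finset.sum_congr rfl fun i _ => ?_
  rw [Finset.sum_product]

/-- `conj(ψ_m(x))·ψ_m(x) = 1`. [folklore] -/
theorem conj_stdAddChar_mul_self {m : ℕ} [NeZero m] (x : ZMod m) :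
    (starRingEnd ℂ) (ZMod.stdAddChar x) * ZMod.stdAddChar x = 1 := by
  rw [← AddChar.map_neg_eq_conj, ← AddChar.map_add_eq_mul, neg_add_cancel, AddChar.map_zero_eq_one]

/-- **`⟨w_{η,m}|w_{η,m}⟩ = P·2ⁿ·Qⁿ`** (unimodular amplitudes on `P·2ⁿ·Qⁿ` distinct points). [folklore] -/
theorem star_wv_dotProduct_wv (h : S.Admissible) (η : Fin S.n → ZMod S.Q) (m : ZMod S.Q) :
    star (S.wv η m) ⬝ᵥ S.wv η m = ((S.P : ℕ) : ℂ) * 2 ^ S.n * ((S.Q : ℕ) : ℂ) ^ S.n := by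
  classical
  set s : Finset (ℕ × (Fin S.n → Fin 2) × (Fin S.n → ZMod S.Q)) :=
    (Finset.range (S.P : ℕ)) ×ˢ ((Finset.univ : Finset (Fin S.n → Fin 2)) ×ˢ
      (Finset.univ : Finset (Fin S.n → ZMod S.Q))) with hs
  set c : ℕ × (Fin S.n → Fin 2) × (Fin S.n → ZMod S.Q) → ℂ :=
    fun a => S.amp7 a.1 a.2.1 * ZMod.stdAddChar (m * (a.1 : ZMod S.Q) + ∑ t, η t * a.2.2 t) with hc
  have hinj : Set.InjOn (fun a : ℕ × (Fin S.n → Fin 2) × (Fin S.n → ZMod S.Q) => S.wpt a.1 a.2.1 a.2.2)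
      ↑s := by
    intro a ha a' ha' hpt
    have hi : a.1 < (S.P : ℕ) := Finset.mem_range.1 (Finset.mem_product.1 (Finset.mem_coe.1 ha)).1
    have hi' : a'.1 < (S.P : ℕ) := Finset.mem_range.1 (Finset.mem_product.1 (Finset.mem_coe.1 ha')).1
    obtain ⟨h1, h2, h3⟩ := S.wpt_inj h hi hi' hpt
    exact Prod.ext h1 (Prod.ext h2 h3)
  have hc1 : ∀ a ∈ s, (starRingEnd ℂ) (c a) * c a = 1 := fun a _ => by
    rw [hc, map_mul, mul_mul_mul_comm, S.conj_amp7_mul_self, conj_stdAddChar_mul_self, one_mul]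
  have hcard : s.card = (S.P : ℕ) * (2 ^ S.n * (S.Q : ℕ) ^ S.n) := by
    rw [hs, Finset.card_product, Finset.card_product, Finset.card_range, Finset.card_univ,
      Finset.card_univ, Fintype.card_pi, Fintype.card_pi, Finset.prod_const, Finset.prod_const,
      Finset.card_univ, Fintype.card_fin, Fintype.card_fin, ZMod.card]
  rw [star_dotProduct_self_pointSum s _ c hinj hc1 (S.wv η m) (S.wv_eq_pointSum η m), hcard]
  push_cast; ring

/-- A non-zero value of `w_{η,m}` sits at a frame point. [folklore] -/
theorem exists_wpt_of_wv_ne_zero {η : Fin S.n → ZMod S.Q} {m : ZMod S.Q} {z : Fin (S.n + 1) → ZMod S.M}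
    (hz : S.wv η m z ≠ 0) : ∃ i, i < (S.P : ℕ) ∧ ∃ k y, z = S.wpt i k y := by
  unfold wv at hz
  obtain ⟨i, hi, hne⟩ := Finset.exists_ne_zero_of_sum_ne_zero hz
  obtain ⟨k, -, hne'⟩ := Finset.exists_ne_zero_of_sum_ne_zero hne
  obtain ⟨y, -, hne''⟩ := Finset.exists_ne_zero_of_sum_ne_zero hne'
  refine ⟨i, Finset.mem_range.1 hi, k, y, ?_⟩
  by_contra hzk
  exact hne'' (if_neg hzk)

/-- The frame vectors are supported in `Dℤⁿ⁺¹` (all `|φ7⟩` points are). [cite: ChenQuantumLattice2024, §3.5.8 p. 33] -/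
theorem wv_support_D (h : S.Admissible) {η : Fin S.n → ZMod S.Q} {m : ZMod S.Q}
    {z : Fin (S.n + 1) → ZMod S.M} (hz : S.wv η m z ≠ 0) :
    ∃ c : Fin (S.n + 1) → ℤ, z = fun i => ((((S.D : ℤ)) * c i : ℤ) : ZMod S.M) := by
  obtain ⟨i, -, k, y, rfl⟩ := S.exists_wpt_of_wv_ne_zero hz
  exact ⟨(S.inst S.b0 (S.vOf (S.yv y))).ctr i k,
    (S.inst S.b0 (S.vOf (S.yv y))).pt7_eq_D_mul_ctr (S.inst_b0_admissible h _) i k⟩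

/-! ### Step 8 (ii)–(v) as one map on kets -/

/-- Step 8 (ii)–(v) as a map on kets: `T ψ := QFT ∘ (phase kick) ∘ (y ↦ ψ(Dy))`, so that
`|φ7.d⟩ = T|φ7⟩` for every instance. [cite: ChenQuantumLattice2024, §3.5.8 p. 33] -/
noncomputable def step8Map (ψ : Ket (S.n + 1) S.M) : Ket (S.n + 1) S.M :=
  qft (kick S.kick8 (S.divideByD (domainExt (S.D : ℕ) ψ)))

/-- `|φ7.d⟩ = T|φ7⟩` for every instance (by construction of (N)'s `phi7d`). [cite: ChenQuantumLattice2024, §3.5.8 p. 33] -/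
theorem phi7d_inst_eq_step8Map (b v : Fin (S.n + 1) → ℤ) :
    (S.inst b v).phi7d = S.step8Map (S.inst b v).phi7 := rfl

/-- Step 8 (ii)–(iii) pointwise: `(divideByD ∘ domainExt) ψ (y) = ψ(D·y)`. [cite: ChenQuantumLattice2024, §3.5.8 p. 33] -/
theorem divideByD_domainExt_apply (ψ : Ket (S.n + 1) S.M) (y : Fin (S.n + 1) → ZMod S.M) :
    S.divideByD (domainExt (S.D : ℕ) ψ) y = ψ (fun i => ((S.D : ℕ) : ZMod S.M) * y i) := by
  unfold divideByD domainExt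
  congr 1
  funext i
  rw [map_natCast]
  push_cast
  rw [ZMod.natCast_zmod_val]

/-- `T ψ (u) = Σ_y ψ(Dy)·e(kick(y))·e(−⟨y,u⟩/M)`. [cite: ChenQuantumLattice2024, §3.5.8 p. 33] -/
theorem step8Map_apply (ψ : Ket (S.n + 1) S.M) (u : Fin (S.n + 1) → ZMod S.M) :
    S.step8Map ψ u = ∑ y : Fin (S.n + 1) → ZMod S.M, ψ (fun i => ((S.D : ℕ) : ZMod S.M) * y i)
      * (e (S.kick8 y) * e (-(((∑ i, (y i).val * (u i).val : ℕ) : ℚ) / (S.M : ℕ)))) := by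
  unfold step8Map qft kick
  refine Finset.sum_congr rfl fun y _ => ?_
  rw [divideByD_domainExt_apply, mul_assoc]

/-- `T` is linear (finite combinations). [folklore] -/
theorem step8Map_linComb {ι : Type*} (s : Finset ι) (a : ι → ℂ) (f : ι → Ket (S.n + 1) S.M)
    (g : Ket (S.n + 1) S.M) (hg : ∀ z, g z = ∑ i ∈ s, a i * f i z) (u : Fin (S.n + 1) → ZMod S.M) :
    S.step8Map g u = ∑ i ∈ s, a i * S.step8Map (f i) u := by
  simp only [step8Map_apply, hg, Finset.sum_mul, Finset.mul_sum]
  rw [Finset.sum_comm]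
  refine Finset.sum_congr rfl fun i _ => Finset.sum_congr rfl fun y _ => ?_
  ring

/-- **`T` is `(MD)^{(n+1)/2}` times an isometry on kets supported in `Dℤⁿ⁺¹`**:
`⟨Tf|Tg⟩ = (MD)ⁿ⁺¹⟨f|g⟩`. [cite: NielsenChuang2010, §2.2.6 p. 90] -/
theorem dotProduct_step8Map (f g : Ket (S.n + 1) S.M)
    (hg : ∀ z, g z ≠ 0 → ∃ c : Fin (S.n + 1) → ℤ, z = fun i => ((((S.D : ℤ)) * c i : ℤ) : ZMod S.M)) :
    star (S.step8Map f) ⬝ᵥ S.step8Map g = (((S.M : ℕ) : ℂ) * (S.D : ℕ)) ^ (S.n + 1) * (star f ⬝ᵥ g) := by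
  unfold step8Map
  rw [dotProduct_qft_qft, dotProduct_kick_kick]
  have hG : ∀ z, (starRingEnd ℂ) (f z) * g z ≠ 0 →
      ∃ c : Fin (S.n + 1) → ℤ, z = fun i => ((((S.D : ℤ)) * c i : ℤ) : ZMod S.M) :=
    fun z hz => hg z fun h0 => hz (by rw [h0, mul_zero])
  have key : ∑ y : Fin (S.n + 1) → ZMod S.M, (starRingEnd ℂ) (f (fun i => ((S.D : ℕ) : ZMod S.M) * y i))
      * g (fun i => ((S.D : ℕ) : ZMod S.M) * y i) = ((S.D : ℕ) : ℂ) ^ (S.n + 1) * ∑ z, (starRingEnd ℂ) (f z) * g z :=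
    S.sum_comp_D_mul (fun z => (starRingEnd ℂ) (f z) * g z) hG
  simp only [dotProduct, Pi.star_apply, Complex.star_def, divideByD_domainExt_apply]
  rw [key, mul_pow]; ring


/-! ### The expansion of `|φ7⟩` of an instance over the frame -/

/-- `σ_B(η) := Σ_t η_t·B_t ∈ ℤ_Q` (tail slopes `b′_{t+1} = 2p₁B_t`). [folklore] -/
def sig (B : Fin S.n → ℤ) (η : Fin S.n → ZMod S.Q) : ZMod S.Q := ∑ t, η t * (B t : ZMod S.Q)

/-- A sum over `j < P` as a sum over `ℤ_P`. [folklore] -/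
theorem sum_range_P_eq (F : ℕ → ℂ) :
    ∑ i ∈ Finset.range (S.P : ℕ), F i = ∑ I : ZMod (S.P : ℕ), F I.val := by
  rw [← sum_range_eq_sum_zmod (S.P : ℕ) (fun I : ZMod (S.P : ℕ) => F I.val)]
  refine Finset.sum_congr rfl fun i hi => ?_
  simp only [ZMod.val_natCast, Nat.mod_eq_of_lt (Finset.mem_range.1 hi)]

/-- Moving a weighted outer sum inside three sums. [folklore] -/
theorem sum_mul_sum₃_comm {α β γ δ : Type*} [Fintype α] [Fintype β] [Fintype γ] [Fintype δ]
    (c : α → ℂ) (F : α → β → γ → δ → ℂ) :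
    ∑ a, c a * ∑ b, ∑ g, ∑ d, F a b g d = ∑ b, ∑ g, ∑ d, ∑ a, c a * F a b g d := by
  simp_rw [Finset.mul_sum]
  rw [Finset.sum_comm]
  refine Finset.sum_congr rfl fun b _ => ?_
  rw [Finset.sum_comm]
  refine Finset.sum_congr rfl fun g _ => ?_
  rw [Finset.sum_comm]

/-- `Σ_i c_i·[p](a·g_i) = [p]·a·Σ_i c_i g_i`. [folklore] -/
theorem sum_mul_ite_zero {α : Type*} [Fintype α] (p : Prop) [Decidable p] (c g : α → ℂ) (a : ℂ) :
    ∑ i, c i * (if p then a * g i else 0) = if p then a * ∑ i, c i * g i else 0 := by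
  split_ifs with h
  · rw [Finset.mul_sum]
    exact Finset.sum_congr rfl fun i _ => by ring
  · simp

/-- A sum of a doubly-guarded term collapses to the inner witness. [folklore] -/
theorem sum_ite_mul_ite {β : Type*} [Fintype β] [DecidableEq β] (pt : β → Prop) [DecidablePred pt]
    (a : β → ℂ) (g q : ℂ) (Y : β) :
    ∑ y, (if pt y then a y * (g * if y = Y then q else 0) else 0) = if pt Y then a Y * (g * q) else 0 := by
  rw [Finset.sum_eq_single Y]
  · rw [if_pos rfl]
  · intro y _ hy
    rw [if_neg hy, mul_zero, mul_zero, ite_self]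
  · intro h
    exact absurd (Finset.mem_univ _) h

/-- **The character sum over the dual variable.** With `c_η = ψ_Q(−⟨η,ȳ⟩ − 2p₁xσ_η − p₁x²)` and the frame
phase `ψ_Q(−2(x+σ_η)·I + ⟨η,y⟩)`: `Σ_η c_η·ψ_Q(…) = ψ_Q(−p₁x² − 2xI)·Qⁿ·[y = ȳ + 2(I + p₁x)B]`. [folklore] -/
theorem sum_coeff_stdAddChar (B : Fin S.n → ℤ) (x : ZMod S.Q) (yb y : Fin S.n → ZMod S.Q) (I' : ZMod S.Q)
    (Y : Fin S.n → ZMod S.Q) (hY : ∀ t, Y t = yb t + 2 * (I' + ((S.p₁ : ℕ) : ZMod S.Q) * x) * (B t : ZMod S.Q)) :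
    ∑ η : Fin S.n → ZMod S.Q,
        ZMod.stdAddChar (-(∑ t, η t * yb t) - 2 * ((S.p₁ : ℕ) : ZMod S.Q) * x * S.sig B η - ((S.p₁ : ℕ) : ZMod S.Q) * x ^ 2)
          * ZMod.stdAddChar (-2 * (x + S.sig B η) * I' + ∑ t, η t * y t)
      = ZMod.stdAddChar (-(((S.p₁ : ℕ) : ZMod S.Q) * x ^ 2) - 2 * x * I')
          * (if y = Y then ((S.Q : ℕ) : ℂ) ^ S.n else 0) := by
  classical
  have hlin : ∀ η : Fin S.n → ZMod S.Q, ∑ t, (y - Y) t * η t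
      = (∑ t, η t * y t) - (∑ t, η t * yb t) - 2 * (I' + ((S.p₁ : ℕ) : ZMod S.Q) * x) * S.sig B η := by
    intro η
    unfold sig
    rw [Finset.mul_sum, ← Finset.sum_sub_distrib, ← Finset.sum_sub_distrib]
    exact Finset.sum_congr rfl fun t _ => by rw [Pi.sub_apply, hY]; ring
  have hterm : ∀ η : Fin S.n → ZMod S.Q,
      ZMod.stdAddChar (-(∑ t, η t * yb t) - 2 * ((S.p₁ : ℕ) : ZMod S.Q) * x * S.sig B η - ((S.p₁ : ℕ) : ZMod S.Q) * x ^ 2)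
          * ZMod.stdAddChar (-2 * (x + S.sig B η) * I' + ∑ t, η t * y t)
        = ZMod.stdAddChar (-(((S.p₁ : ℕ) : ZMod S.Q) * x ^ 2) - 2 * x * I') * ZMod.stdAddChar (∑ t, (y - Y) t * η t) := by
    intro η
    rw [← AddChar.map_add_eq_mul, ← AddChar.map_add_eq_mul, hlin]
    congr 1; ring
  rw [Finset.sum_congr rfl fun η _ => hterm η, ← Finset.mul_sum, sum_stdAddChar_linForm (y - Y)]
  congr 1
  exact if_congr sub_eq_zero rfl rfl

/-- **Expansion of `|φ7⟩` of an instance over the frame.**  For an instance with tail slopes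
`b′_{t+1} = 2p₁B_t` and offset `v′ + L·(x, ȳ)`:
`|φ7⟩ = Q⁻ⁿ Σ_η ψ_Q(−⟨η,ȳ⟩ − 2p₁xσ_B(η) − p₁x²) · w_{η, −2(x+σ_B(η))}` — completing the square
`j ↦ j − p₁x` in eq. (35) moves the head offset `L·x` into the tail (`+2p₁x·B`) and the chirp.
[cite: ChenQuantumLattice2024, eq. (35) p. 31, §3.5.8 p. 34] -/
theorem phi7_inst_expansion (B : Fin S.n → ℤ) {b' : Fin (S.n + 1) → ℤ} (hb0 : b' 0 = -1)
    (hbt : ∀ t : Fin S.n, b' t.succ = 2 * (S.p₁ : ℤ) * B t) (x : ZMod S.Q) (yb : Fin S.n → ZMod S.Q)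
    (z : Fin (S.n + 1) → ZMod S.M) :
    (S.inst b' (S.vOf (S.xyv x yb))).phi7 z
      = (1 / ((S.Q : ℕ) : ℂ) ^ S.n) * ∑ η : Fin S.n → ZMod S.Q,
          ZMod.stdAddChar (-(∑ t, η t * yb t) - 2 * ((S.p₁ : ℕ) : ZMod S.Q) * x * S.sig B η - ((S.p₁ : ℕ) : ZMod S.Q) * x ^ 2)
            * S.wv η (-2 * (x + S.sig B η)) z := by
  classical
  -- opaque abbreviations
  obtain ⟨Y, hY⟩ : ∃ Y : ZMod (S.P : ℕ) → Fin S.n → ZMod S.Q,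
      ∀ I t, Y I t = yb t + 2 * (((I.val : ℕ) : ZMod S.Q) + ((S.p₁ : ℕ) : ZMod S.Q) * x) * (B t : ZMod S.Q) :=
    ⟨_, fun _ _ => rfl⟩
  obtain ⟨χ, hχ⟩ : ∃ χ : ZMod (S.P : ℕ) → ℂ,
      ∀ I, χ I = ZMod.stdAddChar (-(((S.p₁ : ℕ) : ZMod S.Q) * x ^ 2) - 2 * x * ((I.val : ℕ) : ZMod S.Q)) :=
    ⟨_, fun _ => rfl⟩
  obtain ⟨c, hc⟩ : ∃ c : (Fin S.n → ZMod S.Q) → ℂ, ∀ η, c η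
      = ZMod.stdAddChar (-(∑ t, η t * yb t) - 2 * ((S.p₁ : ℕ) : ZMod S.Q) * x * S.sig B η - ((S.p₁ : ℕ) : ZMod S.Q) * x ^ 2) :=
    ⟨_, fun _ => rfl⟩
  obtain ⟨ψ', hψ'⟩ : ∃ ψ' : (Fin S.n → ZMod S.Q) → ZMod (S.P : ℕ) → (Fin S.n → ZMod S.Q) → ℂ,
      ∀ η I y, ψ' η I y
        = ZMod.stdAddChar (-2 * (x + S.sig B η) * ((I.val : ℕ) : ZMod S.Q) + ∑ t, η t * y t) :=
    ⟨_, fun _ _ _ => rfl⟩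
  have hQC : ((S.Q : ℕ) : ℂ) ≠ 0 := by exact_mod_cast S.Q.ne_zero
  -- (1) the points of the instance, re-indexed by `j = I + p₁x`, are frame points with tail offset `Y I`
  have hpt : ∀ (I : ZMod (S.P : ℕ)) (k : Fin S.n → Fin 2),
      (S.inst b' (S.vOf (S.xyv x yb))).pt7 (I + (((S.p₁ : ℕ) * x.val : ℕ) : ZMod (S.P : ℕ))).val k
        = S.wpt I.val k (Y I) := by
    intro I k
    obtain ⟨w, hw⟩ := val_add_natCast_eq (S.P : ℕ) I ((S.p₁ : ℕ) * x.val)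
    funext j
    refine Fin.cases ?_ (fun t => ?_) j
    · rw [pt7_inst_apply, wpt_zero, kLift_zero, hb0, vOf_apply, xyv_zero]
      refine (ZMod.intCast_eq_intCast_iff_dvd_sub _ _ _).2 ⟨-w, ?_⟩
      rw [hw, S.M_coe, L, S.P_coe]
      push_cast
      ring
    · rw [pt7_inst_apply, wpt_succ, kLift_succ, hbt, vOf_apply, xyv_succ]
      have hYres : ((((Y I t).val : ℤ)) : ZMod S.Q)
          = (((((yb t).val : ℤ) + 2 * ((I.val : ℤ) + (S.p₁ : ℕ) * (x.val : ℤ)) * B t : ℤ)) : ZMod S.Q) := by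
        push_cast
        simp only [ZMod.natCast_zmod_val]
        rw [hY]
      obtain ⟨q, hq⟩ := (ZMod.intCast_eq_intCast_iff_dvd_sub _ _ _).1 hYres
      refine (ZMod.intCast_eq_intCast_iff_dvd_sub _ _ _).2 ⟨-q + 2 * (S.p₁ : ℤ) * w * B t, ?_⟩
      have hYv : ((Y I t).val : ℤ)
          = ((yb t).val : ℤ) + 2 * ((I.val : ℤ) + (S.p₁ : ℕ) * (x.val : ℤ)) * B t - (S.Q : ℕ) * q := by
        linarith
      rw [hYv, hw, S.M_eq_L_mul_Q, L, S.P_coe]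
      push_cast
      ring
  -- (2) the amplitudes pick up the chirp character `χ I = ψ_Q(−p₁x² − 2xI)`
  have hamp : ∀ (I : ZMod (S.P : ℕ)) (k : Fin S.n → Fin 2),
      S.amp7 (I + (((S.p₁ : ℕ) * x.val : ℕ) : ZMod (S.P : ℕ))).val k = S.amp7 I.val k * χ I := by
    intro I k
    obtain ⟨w, hw⟩ := val_add_natCast_eq (S.P : ℕ) I ((S.p₁ : ℕ) * x.val)
    have hwq : ((((I + (((S.p₁ : ℕ) * x.val : ℕ) : ZMod (S.P : ℕ))).val : ℕ)) : ℚ)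
        = (I.val : ℚ) + (((S.p₁ : ℕ) * x.val : ℕ) : ℚ) - (S.P : ℕ) * w := by
      exact_mod_cast hw
    unfold amp7
    rw [hχ, mul_right_comm]
    congr 1
    have hψ : ZMod.stdAddChar (-(((S.p₁ : ℕ) : ZMod S.Q) * x ^ 2) - 2 * x * ((I.val : ℕ) : ZMod S.Q))
        = e ((((-(((S.p₁ : ℕ) * x.val ^ 2 + 2 * x.val * I.val : ℕ) : ℤ)) : ℤ) : ℚ) / (S.Q : ℕ)) := by
      rw [e_intCast_div_eq_stdAddChar]
      congr 1
      push_cast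
      simp only [ZMod.natCast_zmod_val]
      ring
    rw [hψ, ← e_add]
    refine e_eq_e_of_sub_eq_intCast (w * (2 * ((I.val : ℤ) + (S.p₁ : ℕ) * x.val) - (S.P : ℕ) * w)) ?_
    rw [hwq]
    push_cast
    rw [S.P_coe_rat]
    have hQ0 : ((S.Q : ℕ) : ℚ) ≠ 0 := by exact_mod_cast S.Q.ne_zero
    have hp0 : ((S.p₁ : ℕ) : ℚ) ≠ 0 := by exact_mod_cast S.p₁.ne_zero
    field_simp
    ring
  -- (3) the left-hand side over `ℤ_P`, re-indexed
  have hL : (S.inst b' (S.vOf (S.xyv x yb))).phi7 z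
      = ∑ I : ZMod (S.P : ℕ), ∑ k : Fin S.n → Fin 2,
          if z = S.wpt I.val k (Y I) then S.amp7 I.val k * χ I else 0 := by
    set F : ℕ → ℂ := fun j => ∑ k : Fin S.n → Fin 2,
      if z = (S.inst b' (S.vOf (S.xyv x yb))).pt7 j k then S.amp7 j k else 0 with hF
    have h1 : (S.inst b' (S.vOf (S.xyv x yb))).phi7 z = ∑ j ∈ Finset.range (S.P : ℕ), F j := rfl
    rw [h1, S.sum_range_P_eq F, ← Fintype.sum_equiv (Equiv.addRight ((((S.p₁ : ℕ) * x.val : ℕ) : ZMod (S.P : ℕ))))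
      (fun I => F (I + (((S.p₁ : ℕ) * x.val : ℕ) : ZMod (S.P : ℕ))).val) (fun J => F J.val) (fun I => rfl)]
    refine Finset.sum_congr rfl fun I _ => ?_
    rw [hF]
    refine Finset.sum_congr rfl fun k _ => ?_
    rw [hpt I k, hamp I k]
  -- (4) the right-hand side over `ℤ_P`
  have hR : ∀ η : Fin S.n → ZMod S.Q, S.wv η (-2 * (x + S.sig B η)) z
      = ∑ I : ZMod (S.P : ℕ), ∑ k : Fin S.n → Fin 2, ∑ y : Fin S.n → ZMod S.Q,
          if z = S.wpt I.val k y then S.amp7 I.val k * ψ' η I y else 0 := by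
    intro η
    simp only [wv, hψ']
    exact S.sum_range_P_eq _
  -- (5) the character sum over `η`
  have hKP : ∀ (I : ZMod (S.P : ℕ)) (y : Fin S.n → ZMod S.Q),
      ∑ η, c η * ψ' η I y = χ I * (if y = Y I then ((S.Q : ℕ) : ℂ) ^ S.n else 0) := by
    intro I y
    simp only [hc, hψ', hχ]
    exact S.sum_coeff_stdAddChar B x yb y ((I.val : ℕ) : ZMod S.Q) (Y I) (hY I)
  have hR' : (∑ η : Fin S.n → ZMod S.Q,
      ZMod.stdAddChar (-(∑ t, η t * yb t) - 2 * ((S.p₁ : ℕ) : ZMod S.Q) * x * S.sig B η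
          - ((S.p₁ : ℕ) : ZMod S.Q) * x ^ 2) * S.wv η (-2 * (x + S.sig B η)) z)
      = ∑ η, c η * ∑ I : ZMod (S.P : ℕ), ∑ k : Fin S.n → Fin 2, ∑ y : Fin S.n → ZMod S.Q,
          if z = S.wpt I.val k y then S.amp7 I.val k * ψ' η I y else 0 :=
    Finset.sum_congr rfl fun η _ => by rw [← hc η, hR η]
  -- assemble
  rw [hL, hR', sum_mul_sum₃_comm]
  simp_rw [sum_mul_ite_zero, hKP]
  simp_rw [sum_ite_mul_ite]
  rw [Finset.mul_sum]
  refine Finset.sum_congr rfl fun I _ => ?_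
  rw [Finset.mul_sum]
  refine Finset.sum_congr rfl fun k _ => ?_
  split_ifs
  · field_simp
  · rw [mul_zero]


/-! ### The instance family and the read-out bound -/

/-- Reordering three sums. [folklore] -/
theorem sum_sum_sum_comm₃ {α β γ R : Type*} [Fintype α] [Fintype β] [Fintype γ] [AddCommMonoid R]
    (G : α → β → γ → R) : ∑ a, ∑ b, ∑ c, G a b c = ∑ c, ∑ b, ∑ a, G a b c := by
  rw [Finset.sum_comm]
  refine (Finset.sum_congr rfl fun b _ => Finset.sum_comm).trans ?_
  rw [Finset.sum_comm]

/-- Tail slope data of the family: the true `b_{t+1}/(2p₁)` off `t₁`, shifted by a dummy `β` at the unknown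
coordinate `t₁+1`. [cite: ChenQuantumLattice2024, §3.1 p. 22] -/
def Bfam (t₁ : Fin S.n) (β : ZMod S.Q) (t : Fin S.n) : ℤ :=
  S.b t.succ / (2 * (S.p₁ : ℤ)) + if t = t₁ then (β.val : ℤ) else 0

/-- The slope vector of the family: `(−1, 2p₁·Bfam)`. [cite: ChenQuantumLattice2024, §3.1 p. 22] -/
def famB (t₁ : Fin S.n) (β : ZMod S.Q) : Fin (S.n + 1) → ℤ :=
  Fin.cons (-1) fun t => 2 * (S.p₁ : ℤ) * S.Bfam t₁ β t

/-- `famB β 0 = −1`. [cite: ChenQuantumLattice2024, Cond. C.3 p. 18] -/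
@[simp] theorem famB_zero (t₁ : Fin S.n) (β : ZMod S.Q) : S.famB t₁ β 0 = -1 := by simp [famB]
/-- `famB β (t+1) = 2p₁·Bfam β t`. [cite: ChenQuantumLattice2024, Cond. C.3 p. 18] -/
@[simp] theorem famB_succ (t₁ : Fin S.n) (β : ZMod S.Q) (t : Fin S.n) :
    S.famB t₁ β t.succ = 2 * (S.p₁ : ℤ) * S.Bfam t₁ β t := by
  simp [famB]

/-- Every member `(famB β, v′ + L·c)` of the family lies in the instance class of any `U ∋ t₁+1`.
[cite: ChenQuantumLattice2024, Cond. C.3 p. 18, §3.1 p. 22] -/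
theorem inClass_fam (h : S.Admissible) (t₁ : Fin S.n) {U : Finset (Fin (S.n + 1))} (hU : t₁.succ ∈ U)
    (β : ZMod S.Q) (c : Fin (S.n + 1) → ℤ) : S.InClass U (S.famB t₁ β) (S.vOf c) := by
  refine ⟨fun i hi => ?_, S.inst_vOf_admissible h (S.famB_zero t₁ β) (fun i hi0 => ?_) c⟩
  · revert hi
    refine Fin.cases ?_ (fun t => ?_) i
    · intro _
      rw [famB_zero, h.b_head]
    · intro ht
      have hne : t ≠ t₁ := by
        rintro rfl
        exact ht hU
      rw [famB_succ, Bfam, if_neg hne, add_zero]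
      exact Int.mul_ediv_cancel' (h.b_tail t.succ (Fin.succ_ne_zero t))
  · obtain ⟨t, rfl⟩ := Fin.exists_succ_eq.2 hi0
    rw [famB_succ]
    exact dvd_mul_right _ _

/-- `σ_{Bfam β}(η) = σ₀(η) + η_{t₁}·β`. [folklore] -/
theorem sig_Bfam (t₁ : Fin S.n) (β : ZMod S.Q) (η : Fin S.n → ZMod S.Q) :
    S.sig (S.Bfam t₁ β) η = S.sig (fun t => S.b t.succ / (2 * (S.p₁ : ℤ))) η + η t₁ * β := by
  unfold sig Bfam
  simp only [Int.cast_add, Int.cast_ite, Int.cast_natCast, ZMod.natCast_zmod_val, Int.cast_zero, mul_add,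
    Finset.sum_add_distrib, mul_ite, mul_zero, Finset.sum_ite_eq', Finset.mem_univ, if_true]

/-- The Step-9 datum of a member of the family is `v′₀ + L·x (mod N)`. [cite: ChenQuantumLattice2024, §3.5.9 p. 37] -/
theorem step9Needs_fam (b' : Fin (S.n + 1) → ℤ) (x : ZMod S.Q) (yb : Fin S.n → ZMod S.Q) :
    (S.inst b' (S.vOf (S.xyv x yb))).step9Needs = (((S.v' 0 + S.L * x.val : ℤ)) : ZMod S.N) := by
  show ((((S.vOf (S.xyv x yb) 0 : ℤ)) : ZMod S.N)) = _
  rw [vOf_apply, xyv_zero]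

/-- **The `Q` labels are distinct**: `v′₀ + Lx ≡ v′₀ + Lx′ (mod N) ⇒ x = x′` (`N/L = Q/2`, `Q` odd).
[cite: ChenQuantumLattice2024, Cond. C.3 p. 18] -/
theorem label_inj (h : S.Admissible) {x x' : ZMod S.Q}
    (hx : (((S.v' 0 + S.L * x.val : ℤ)) : ZMod S.N) = (((S.v' 0 + S.L * x'.val : ℤ)) : ZMod S.N)) :
    x = x' := by
  rw [ZMod.intCast_eq_intCast_iff_dvd_sub, N_eq_DDpQ] at hx
  have h1 : (S.D : ℤ) * S.D * S.p₁ * S.Q ∣ ((S.D : ℤ) * S.D * S.p₁) * ((((x'.val : ℤ) - x.val)) * 2) := by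
    have : S.v' 0 + S.L * x'.val - (S.v' 0 + S.L * x.val)
        = ((S.D : ℤ) * S.D * S.p₁) * ((((x'.val : ℤ) - x.val)) * 2) := by rw [L]; ring
    rwa [this] at hx
  have hD0 : (S.D : ℤ) ≠ 0 := by exact_mod_cast S.D.ne_zero
  have hp0 : (S.p₁ : ℤ) ≠ 0 := by exact_mod_cast S.p₁.ne_zero
  have hD : (S.D : ℤ) * S.D * S.p₁ ≠ 0 := mul_ne_zero (mul_ne_zero hD0 hD0) hp0
  rw [mul_dvd_mul_iff_left hD] at h1
  have hcop : IsCoprime ((S.Q : ℕ) : ℤ) ((2 : ℕ) : ℤ) :=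
    Nat.isCoprime_iff_coprime.2 (Nat.coprime_two_right.2 h.odd_Q)
  have h2 : ((S.Q : ℕ) : ℤ) ∣ (x'.val : ℤ) - x.val := hcop.dvd_of_dvd_mul_right (by exact_mod_cast h1)
  exact ZMod.val_injective _ (nat_eq_of_dvd_sub_of_lt (ZMod.val_lt x) (ZMod.val_lt x') h2)

/-- **Sandwich over the unknown tail offsets.** For fixed slopes and head offset `x`, summing the weight
of an outcome set `F` over the `Qⁿ` tail offsets `ȳ` of the class gives
`Q⁻ⁿ Σ_η (weight of F on T w_{η, −2(x+σ(η))})` — cross terms die by orthogonality of characters in `ȳ`.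
[cite: NielsenChuang2010, §2.2.6 p. 90] -/
theorem sum_weight_fam_eq {κ : Type*} [Fintype κ] [DecidableEq κ]
    (E : POVM (Fin (S.n + 1) → ZMod S.M) κ) (F : Finset κ) (B : Fin S.n → ℤ) {b' : Fin (S.n + 1) → ℤ}
    (hb0 : b' 0 = -1) (hbt : ∀ t : Fin S.n, b' t.succ = 2 * (S.p₁ : ℤ) * B t) (x : ZMod S.Q) :
    ∑ yb : Fin S.n → ZMod S.Q, ∑ k ∈ F, E.weight (S.inst b' (S.vOf (S.xyv x yb))).phi7d k
      = (1 / ((S.Q : ℕ) : ℂ) ^ S.n) * ∑ η : Fin S.n → ZMod S.Q,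
          ∑ k ∈ F, E.weight (S.step8Map (S.wv η (-2 * (x + S.sig B η)))) k := by
  classical
  set c : ℂ := 1 / ((S.Q : ℕ) : ℂ) ^ S.n with hcdef
  obtain ⟨a, ha⟩ : ∃ a : (Fin S.n → ZMod S.Q) → ℂ, ∀ η, a η = ZMod.stdAddChar
      (-(2 * ((S.p₁ : ℕ) : ZMod S.Q) * x * S.sig B η) - ((S.p₁ : ℕ) : ZMod S.Q) * x ^ 2) :=
    ⟨_, fun _ => rfl⟩
  have ha1 : ∀ η, (starRingEnd ℂ) (a η) * a η = 1 := fun η => by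
    rw [ha]; exact conj_stdAddChar_mul_self _
  -- the kets of the family as character combinations of the kets `a η · T w_{η,m(η)}`
  have hφ : ∀ (yb : Fin S.n → ZMod S.Q) (p : Fin (S.n + 1) → ZMod S.M),
      (S.inst b' (S.vOf (S.xyv x yb))).phi7d p
        = c * ∑ η : Fin S.n → ZMod S.Q, ZMod.stdAddChar (-(∑ t, η t * yb t))
            * (a η * S.step8Map (S.wv η (-2 * (x + S.sig B η))) p) := by
    intro yb p
    rw [phi7d_inst_eq_step8Map]
    rw [S.step8Map_linComb Finset.univ
        (fun η => c * ZMod.stdAddChar (-(∑ t, η t * yb t) - 2 * ((S.p₁ : ℕ) : ZMod S.Q) * x * S.sig B η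
          - ((S.p₁ : ℕ) : ZMod S.Q) * x ^ 2))
        (fun η => S.wv η (-2 * (x + S.sig B η))) _ (fun z => by
          rw [S.phi7_inst_expansion B hb0 hbt x yb z, Finset.mul_sum]
          exact Finset.sum_congr rfl fun η _ => by ring) p]
    rw [Finset.mul_sum]
    refine Finset.sum_congr rfl fun η _ => ?_
    have hsplit : ZMod.stdAddChar (-(∑ t, η t * yb t) - 2 * ((S.p₁ : ℕ) : ZMod S.Q) * x * S.sig B η
          - ((S.p₁ : ℕ) : ZMod S.Q) * x ^ 2)
        = ZMod.stdAddChar (-(∑ t, η t * yb t)) * a η := by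
      rw [ha, ← AddChar.map_add_eq_mul]; congr 1; ring
    rw [hsplit]; ring
  have hsand := sum_quadForm_fourier (∑ k ∈ F, E.effect k)
    (fun η p => a η * S.step8Map (S.wv η (-2 * (x + S.sig B η))) p) c
    (fun yb => (S.inst b' (S.vOf (S.xyv x yb))).phi7d) hφ
  have hcc : (starRingEnd ℂ) c * c * (((S.Q : ℕ) : ℂ)) ^ S.n = c := by
    have hQ : ((S.Q : ℕ) : ℂ) ≠ 0 := by exact_mod_cast S.Q.ne_zero
    have hcr : (starRingEnd ℂ) c = c := by rw [hcdef]; simp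
    rw [hcr, hcdef]
    field_simp
  calc ∑ yb : Fin S.n → ZMod S.Q, ∑ k ∈ F, E.weight (S.inst b' (S.vOf (S.xyv x yb))).phi7d k
      = ∑ yb : Fin S.n → ZMod S.Q, star (S.inst b' (S.vOf (S.xyv x yb))).phi7d
          ⬝ᵥ ((∑ k ∈ F, E.effect k) *ᵥ (S.inst b' (S.vOf (S.xyv x yb))).phi7d) :=
        Finset.sum_congr rfl fun yb _ => E.sum_weight_eq_dotProduct F _
    _ = _ := hsand
    _ = c * ∑ η : Fin S.n → ZMod S.Q, ∑ k ∈ F, E.weight (S.step8Map (S.wv η (-2 * (x + S.sig B η)))) k := by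
        rw [hcc]
        refine congrArg _ (Finset.sum_congr rfl fun η _ => ?_)
        rw [← E.sum_weight_eq_dotProduct F]
        exact Finset.sum_congr rfl fun k _ => E.weight_unimodular_mul (ha1 η) _ k

/-- **READ-OUT BOUND (the direct question, quantitative).**  Let the Step-8 register hold `|φ7.d⟩` of an
admissible instance of the class "slope unknown at coordinate `t₁+1`" and let ANY general measurement
(POVM `E`, any outcome type) followed by ANY classical decoder `dec` try to output the Step-9 datum
`v′₀ mod D²P`.  Then on some instance of the class the success weight is at most
`pairsCount(Q)/Q² · ⟨φ7.d|φ7.d⟩` (`pairsCount(Q)/Q² = (2Q−1)/Q²` for prime `Q`, `< 2/3` always):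
averaging over the `Q^{n+2}` instances `(β, x, ȳ)` (dummy slope `β` at `t₁`, head offset `x`, tail offsets
`ȳ`), the partial Fourier transform in `ȳ` block-diagonalises the problem into the frames `w_{η,·}`
(`η ∈ ℤ_Qⁿ`); in block `η` the `Q` head offsets `x` with the same `m = −2(x + σ₀(η) + η_{t₁}β)` present the
SAME state but need DIFFERENT answers, and `β ↦ m` is `kerCount(η_{t₁})`-to-one.
[cite: ChenQuantumLattice2024, §3.5.8 pp. 33–34, §3.5.9 p. 37; NielsenChuang2010, §2.2.6 p. 90] -/
theorem step9Needs_readout_le (h : S.Admissible) (t₁ : Fin S.n) {U : Finset (Fin (S.n + 1))}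
    (hU : t₁.succ ∈ U) {κ : Type*} [Fintype κ] [DecidableEq κ]
    (E : POVM (Fin (S.n + 1) → ZMod S.M) κ) (dec : κ → ZMod S.N) :
    ∃ b₂ v₂ : Fin (S.n + 1) → ℤ, S.InClass U b₂ v₂ ∧
      (∑ k ∈ Finset.univ.filter (fun k => dec k = (S.inst b₂ v₂).step9Needs),
          (E.weight (S.inst b₂ v₂).phi7d k).re)
        ≤ (pairsCount (S.Q : ℕ) : ℝ) / ((S.Q : ℕ) : ℝ) ^ 2
            * (star (S.inst b₂ v₂).phi7d ⬝ᵥ (S.inst b₂ v₂).phi7d).re := by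
  -- opaque abbreviations: labels `ℓ`, frame read-out weights `g`, the known part `σ₀` of `σ`
  obtain ⟨ℓ, hℓ⟩ : ∃ ℓ : ZMod S.Q → ZMod S.N, ∀ x, ℓ x = (((S.v' 0 + S.L * x.val : ℤ)) : ZMod S.N) :=
    ⟨_, fun _ => rfl⟩
  obtain ⟨g, hg⟩ : ∃ g : (Fin S.n → ZMod S.Q) → ZMod S.Q → ZMod S.Q → ℝ, ∀ η m x, g η m x
      = ∑ k ∈ Finset.univ.filter (fun k => dec k = ℓ x), (E.weight (S.step8Map (S.wv η m)) k).re :=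
    ⟨_, fun _ _ _ => rfl⟩
  obtain ⟨σ₀, hσ₀⟩ : ∃ σ₀ : (Fin S.n → ZMod S.Q) → ZMod S.Q,
      ∀ η, σ₀ η = S.sig (fun t => S.b t.succ / (2 * (S.p₁ : ℤ))) η := ⟨_, fun _ => rfl⟩
  set n₀ : ℝ := (((S.M : ℕ) : ℝ) * (S.D : ℕ)) ^ (S.n + 1) * (((S.P : ℕ) : ℝ) * 2 ^ S.n) with hn₀
  have hQpos : (0 : ℝ) < ((S.Q : ℕ) : ℝ) := by exact_mod_cast S.Q.pos
  have hg0 : ∀ η m x, 0 ≤ g η m x := fun η m x => by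
    rw [hg]; exact Finset.sum_nonneg fun k _ => E.weight_re_nonneg _ k
  -- (K0) labels and norms of the family
  have hlabel : ∀ (β x : ZMod S.Q) (yb : Fin S.n → ZMod S.Q),
      (S.inst (S.famB t₁ β) (S.vOf (S.xyv x yb))).step9Needs = ℓ x := fun β x yb => by
    rw [hℓ, step9Needs_fam]
  have hnorm : ∀ (β x : ZMod S.Q) (yb : Fin S.n → ZMod S.Q),
      (star (S.inst (S.famB t₁ β) (S.vOf (S.xyv x yb))).phi7d
        ⬝ᵥ (S.inst (S.famB t₁ β) (S.vOf (S.xyv x yb))).phi7d).re = n₀ := by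
    intro β x yb
    rw [S.star_phi7d_dotProduct_phi7d_inst (S.inClass_fam h t₁ hU β _).2]
    have hc : (((S.M : ℕ) : ℂ) * (S.D : ℕ)) ^ (S.n + 1) * (((S.P : ℕ) : ℂ) * 2 ^ S.n) = ((n₀ : ℝ) : ℂ) := by
      rw [hn₀]; push_cast; ring
    rw [hc, Complex.ofReal_re]
  -- (K1) sandwich over the tail offsets, real form
  have hK1 : ∀ β x : ZMod S.Q, ∑ yb : Fin S.n → ZMod S.Q,
      ∑ k ∈ Finset.univ.filter (fun k => dec k = ℓ x),
        (E.weight (S.inst (S.famB t₁ β) (S.vOf (S.xyv x yb))).phi7d k).re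
      = (1 / ((S.Q : ℕ) : ℝ) ^ S.n) * ∑ η, g η (-2 * (x + (σ₀ η + η t₁ * β))) x := by
    intro β x
    have hc := S.sum_weight_fam_eq E (Finset.univ.filter (fun k => dec k = ℓ x)) (S.Bfam t₁ β)
      (S.famB_zero t₁ β) (S.famB_succ t₁ β) x
    simp_rw [S.sig_Bfam, ← hσ₀] at hc
    have hre := congrArg Complex.re hc
    simp_rw [Complex.re_sum] at hre
    rw [hre]
    have hcast : (1 / ((S.Q : ℕ) : ℂ) ^ S.n) = (((1 / ((S.Q : ℕ) : ℝ) ^ S.n : ℝ)) : ℂ) := by push_cast; ring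
    rw [hcast, Complex.re_ofReal_mul, Complex.re_sum]
    congr 1
    refine Finset.sum_congr rfl fun η _ => ?_
    rw [hg, Complex.re_sum]
  -- (K2) the dummy slope: `β ↦ m` is `kerCount(η t₁)`-to-one
  have hK2 : ∀ (η : Fin S.n → ZMod S.Q) (x : ZMod S.Q),
      ∑ β : ZMod S.Q, g η (-2 * (x + (σ₀ η + η t₁ * β))) x
        ≤ (kerCount (S.Q : ℕ) (η t₁) : ℝ) * ∑ m, g η m x := fun η x =>
    sum_comp_le_of_card_fibre_le (fun β : ZMod S.Q => -2 * (x + (σ₀ η + η t₁ * β))) (fun m => g η m x)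
      (fun m => hg0 η m x) _ (fun m => card_fibre_affine_le h.odd_Q x (σ₀ η) (η t₁) m)
  -- (K3) the head offset: `Q` distinct answers from one frame state
  have hK3 : ∀ (η : Fin S.n → ZMod S.Q) (m : ZMod S.Q),
      ∑ x : ZMod S.Q, g η m x ≤ ((S.Q : ℕ) : ℝ) ^ S.n * n₀ := by
    intro η m
    simp_rw [hg]
    have h1 := E.sum_sum_filter_weight_re_le dec Finset.univ ℓ
      (fun x _ x' _ hxx => S.label_inj h (by rw [← hℓ, ← hℓ]; exact hxx)) (S.step8Map (S.wv η m))
    refine h1.trans (le_of_eq ?_)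
    rw [S.dotProduct_step8Map _ _ (fun z hz => S.wv_support_D h hz), S.star_wv_dotProduct_wv h]
    have hc : (((S.M : ℕ) : ℂ) * (S.D : ℕ)) ^ (S.n + 1) * (((S.P : ℕ) : ℂ) * 2 ^ S.n * ((S.Q : ℕ) : ℂ) ^ S.n)
        = (((((S.Q : ℕ) : ℝ) ^ S.n * n₀ : ℝ)) : ℂ) := by
      rw [hn₀]; push_cast; ring
    rw [hc, Complex.ofReal_re]
  -- (K4) counting: `Q · Σ_η kerCount(η t₁) = Qⁿ · pairsCount Q`
  have hK4 : ((S.Q : ℕ) : ℝ) * ∑ η : Fin S.n → ZMod S.Q, (kerCount (S.Q : ℕ) (η t₁) : ℝ)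
      = ((S.Q : ℕ) : ℝ) ^ S.n * (pairsCount (S.Q : ℕ) : ℝ) := by
    have h1 := card_mul_sum_apply_coord (R := ℝ) t₁ (fun a : ZMod S.Q => (kerCount (S.Q : ℕ) a : ℝ))
    rw [ZMod.card] at h1
    rw [h1, pairsCount_eq_sum_kerCount]
    push_cast
    rfl
  -- total over the family
  have htot : ∑ p : ZMod S.Q × ZMod S.Q × (Fin S.n → ZMod S.Q),
      ∑ k ∈ Finset.univ.filter (fun k => dec k = ℓ p.2.1),
        (E.weight (S.inst (S.famB t₁ p.1) (S.vOf (S.xyv p.2.1 p.2.2))).phi7d k).re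
      ≤ ((S.Q : ℕ) : ℝ) ^ S.n * (pairsCount (S.Q : ℕ) : ℝ) * n₀ := by
    rw [Fintype.sum_prod_type]
    simp_rw [Fintype.sum_prod_type]
    simp_rw [hK1]
    simp_rw [← Finset.mul_sum]
    rw [sum_sum_sum_comm₃]
    calc (1 / ((S.Q : ℕ) : ℝ) ^ S.n) * ∑ η, ∑ x, ∑ β, g η (-2 * (x + (σ₀ η + η t₁ * β))) x
        ≤ (1 / ((S.Q : ℕ) : ℝ) ^ S.n) * ∑ η, ∑ x : ZMod S.Q, (kerCount (S.Q : ℕ) (η t₁) : ℝ) * ∑ m, g η m x :=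
          mul_le_mul_of_nonneg_left (Finset.sum_le_sum fun η _ => Finset.sum_le_sum fun x _ => hK2 η x)
            (by positivity)
      _ = (1 / ((S.Q : ℕ) : ℝ) ^ S.n) * ∑ η, (kerCount (S.Q : ℕ) (η t₁) : ℝ) * ∑ m, ∑ x : ZMod S.Q, g η m x := by
          congr 1
          refine Finset.sum_congr rfl fun η _ => ?_
          rw [← Finset.mul_sum, Finset.sum_comm]
      _ ≤ (1 / ((S.Q : ℕ) : ℝ) ^ S.n) * ∑ η : Fin S.n → ZMod S.Q,
            (kerCount (S.Q : ℕ) (η t₁) : ℝ) * ∑ m : ZMod S.Q, ((S.Q : ℕ) : ℝ) ^ S.n * n₀ :=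
          mul_le_mul_of_nonneg_left (Finset.sum_le_sum fun η _ =>
            mul_le_mul_of_nonneg_left (Finset.sum_le_sum fun m _ => hK3 η m) (Nat.cast_nonneg _))
            (by positivity)
      _ = ((S.Q : ℕ) : ℝ) ^ S.n * (pairsCount (S.Q : ℕ) : ℝ) * n₀ := by
          rw [Finset.sum_const, Finset.card_univ, ZMod.card, nsmul_eq_mul, ← Finset.sum_mul]
          have hQn : ((S.Q : ℕ) : ℝ) ^ S.n ≠ 0 := by positivity
          calc (1 / ((S.Q : ℕ) : ℝ) ^ S.n) * ((∑ η : Fin S.n → ZMod S.Q, (kerCount (S.Q : ℕ) (η t₁) : ℝ))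
                * (((S.Q : ℕ) : ℝ) * (((S.Q : ℕ) : ℝ) ^ S.n * n₀)))
              = (1 / ((S.Q : ℕ) : ℝ) ^ S.n) * (((S.Q : ℕ) : ℝ) ^ S.n * n₀)
                  * (((S.Q : ℕ) : ℝ) * ∑ η : Fin S.n → ZMod S.Q, (kerCount (S.Q : ℕ) (η t₁) : ℝ)) := by ring
            _ = ((S.Q : ℕ) : ℝ) ^ S.n * (pairsCount (S.Q : ℕ) : ℝ) * n₀ := by
                  rw [hK4]; field_simp
  -- the same total, as a constant
  have hconst : ∑ _p : ZMod S.Q × ZMod S.Q × (Fin S.n → ZMod S.Q),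
      (pairsCount (S.Q : ℕ) : ℝ) / ((S.Q : ℕ) : ℝ) ^ 2 * n₀
      = ((S.Q : ℕ) : ℝ) ^ S.n * (pairsCount (S.Q : ℕ) : ℝ) * n₀ := by
    rw [Finset.sum_const, Finset.card_univ, Fintype.card_prod, Fintype.card_prod, ZMod.card, Fintype.card_pi,
      Finset.prod_const, Finset.card_univ, Fintype.card_fin, ZMod.card, nsmul_eq_mul]
    push_cast
    field_simp
  -- pigeonhole
  obtain ⟨⟨β, x, yb⟩, -, hle⟩ := Finset.exists_le_of_sum_le Finset.univ_nonempty
    (htot.trans (le_of_eq hconst.symm))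
  refine ⟨S.famB t₁ β, S.vOf (S.xyv x yb), S.inClass_fam h t₁ hU β _, ?_⟩
  rw [hlabel, hnorm]
  exact hle

/-- **No general measurement + decoder outputs `v′₀ mod D²P` from `|φ7.d⟩` with constant confidence.**
For every admissible shape with `n ≥ 1`, every POVM on the Step-8 register valued in `ℤ_{D²P}` and every
`ε < 1 − pairsCount(Q)/Q²` (in particular every `ε ≤ 1/3`, next corollary), some admissible instance has
`weight(v′₀ mod D²P) < (1−ε)·⟨φ7.d|φ7.d⟩` — superseding the tolerance hypotheses `4εP² < 1` of
`step9Needs_not_almostSurely_measurable` and `4εQ² < 1` of `…_sharp`. [cite: ChenQuantumLattice2024, §3.5.8 p. 34, §3.5.9 p. 37] -/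
theorem step9Needs_not_almostCertain_of_lt (h : S.Admissible) (hn : 0 < S.n)
    (E : POVM (Fin (S.n + 1) → ZMod S.M) (ZMod S.N)) {ε : ℝ}
    (hε : ε < 1 - (pairsCount (S.Q : ℕ) : ℝ) / ((S.Q : ℕ) : ℝ) ^ 2) :
    ¬ ∀ b₂ v₂ : Fin (S.n + 1) → ℤ, (S.inst b₂ v₂).Admissible →
        E.AlmostCertain ε (S.inst b₂ v₂).phi7d (S.inst b₂ v₂).step9Needs := by
  intro hall
  obtain ⟨b₂, v₂, hcl, hle⟩ :=
    S.step9Needs_readout_le h ⟨0, hn⟩ (U := Finset.univ) (Finset.mem_univ _) E id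
  have hI := hcl.2
  have hw := hall b₂ v₂ hI
  unfold POVM.AlmostCertain at hw
  have hmem : (S.inst b₂ v₂).step9Needs
      ∈ Finset.univ.filter (fun k : ZMod S.N => id k = (S.inst b₂ v₂).step9Needs) :=
    Finset.mem_filter.2 ⟨Finset.mem_univ _, rfl⟩
  have hle' := le_trans (Finset.single_le_sum (f := fun k => (E.weight (S.inst b₂ v₂).phi7d k).re)
    (fun k _ => E.weight_re_nonneg _ k) hmem) hle
  have hpos : 0 < (star (S.inst b₂ v₂).phi7d ⬝ᵥ (S.inst b₂ v₂).phi7d).re := by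
    rw [S.star_phi7d_dotProduct_phi7d_inst hI]
    have hc : (((S.M : ℕ) : ℂ) * (S.D : ℕ)) ^ (S.n + 1) * (((S.P : ℕ) : ℂ) * 2 ^ S.n)
        = ((((((S.M : ℕ) : ℝ) * (S.D : ℕ)) ^ (S.n + 1) * (((S.P : ℕ) : ℝ) * 2 ^ S.n) : ℝ)) : ℂ) := by
      push_cast; ring
    rw [hc, Complex.ofReal_re]
    have hM : (0 : ℝ) < (S.M : ℕ) := by exact_mod_cast S.M.pos
    have hD : (0 : ℝ) < (S.D : ℕ) := by exact_mod_cast S.D.pos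
    have hP : (0 : ℝ) < (S.P : ℕ) := by exact_mod_cast S.P.pos
    positivity
  have h1 := le_of_mul_le_mul_right (hw.trans hle') hpos
  linarith

/-- `pairsCount(Q)/Q² < 2/3` for an admissible shape (`Q` odd, `≥ 3`). [folklore] -/
theorem pairsCount_div_sq_lt (h : S.Admissible) :
    (pairsCount (S.Q : ℕ) : ℝ) / ((S.Q : ℕ) : ℝ) ^ 2 < 2 / 3 := by
  have h3 : ((3 * pairsCount (S.Q : ℕ) : ℕ) : ℝ) < ((2 * (S.Q : ℕ) ^ 2 : ℕ) : ℝ) := by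
    exact_mod_cast three_mul_pairsCount_lt h.odd_Q h.three_le_Q
  push_cast at h3
  have hQ : (0 : ℝ) < ((S.Q : ℕ) : ℝ) ^ 2 := by
    have : (0 : ℝ) < ((S.Q : ℕ) : ℝ) := by exact_mod_cast S.Q.pos
    positivity
  rw [div_lt_iff₀ hQ]
  linarith

/-- **Corollary (ε ≤ 1/3).** No general measurement of the Step-8 register outputs the Step-9 datum with
confidence `2/3` on all admissible instances. [cite: ChenQuantumLattice2024, §3.5.8 p. 34, §3.5.9 p. 37] -/
theorem step9Needs_not_almostCertain_third (h : S.Admissible) (hn : 0 < S.n)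
    (E : POVM (Fin (S.n + 1) → ZMod S.M) (ZMod S.N)) {ε : ℝ} (hε : ε ≤ 1 / 3) :
    ¬ ∀ b₂ v₂ : Fin (S.n + 1) → ℤ, (S.inst b₂ v₂).Admissible →
        E.AlmostCertain ε (S.inst b₂ v₂).phi7d (S.inst b₂ v₂).step9Needs :=
  S.step9Needs_not_almostCertain_of_lt h hn E (by have := S.pairsCount_div_sq_lt h; linarith)

end Shape

end Literature.Computability.Cryptography.Chen2024
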